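import Literature.MathematicalPhysics.QuantumFieldTheory.Balaban1983to89.Beta.AveragingGaugeModes
import Mathlib.Algebra.DualNumber

/-!
# `Balaban1983to89.Beta.AveragingThirdJet` — the THIRD background jet `T₂` of the linearised one-step averaging as
# an EXACT FORMAL OBJECT: a nilpotent-parameter model of Bałaban's covariant averaging (15)/(42) at GROUP level, its
# exact gauge covariance (11), the `(B,B′)`-polarised averaged jet `Qjet`, the order-`B²` WARD IDENTITY on `𝔫_ev`,
# and the identification of its orders `B⁰`, `B¹` with node 5's `linAvg` and node 7a's `vhU`, v1

HONEST FRAMING (page 1, mandatory).  This leaf belongs to the β sub-cell of the Bałaban audit, whose END STATEMENT is: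
discharging the one-loop hypothesis `FlowStep.BetaPertH` (read at END-STATEMENT grade, RULING (R6)) makes Bałaban's
ultraviolet stability theorem for 4-d lattice Yang–Mills ([Balaban1989LargeFieldII], Thm. 1 p. 355 (B16))
UNCONDITIONAL inside this package — a real constructive-QFT result; it is NOT the continuum limit and NOT the Clay
problem.  Gloss 2: EVERYTHING below is kernel-proved [folklore] ALGEBRA — words in a free abelian letter group, finite
sums, and polynomial identities in rings with square-zero central formal parameters over a field `𝕜`; there is no
analysis in this file and NOTHING is cited as a fact.  [Balaban1985Averaging] (= B7) and
[Balaban1985BackgroundPropagators] (= B9) are named only to say WHICH objects are being typed; the manuscripts under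
audit are not citable for their disputed steps and no programme-internal claim enters.

ABSOLUTE RULE (cell charter, verbatim): «No internally-minted statement may enter as a cited fact. Every hypothesis is
either kernel-proved in this package or a verbatim quotation of a PUBLISHED theorem with page reference. The
manuscript(s) under audit are NOT citable for their own disputed steps — they are the thing under adjudication;
programme-internal (2001/route/tribunal) claims are never citable.»  Accordingly NO declaration below is a
`def … : Prop` carrying a citation and no hypothesis of any theorem is a printed statement: every declaration is
[folklore]; printed displays are object LOCATORS only.

THE PRINTED OBJECTS (locators only; NOTHING printed is asserted, at any order).  B7 p.19 (15) «We define Ū_c =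
exp[i Σ_{x∈B(c_−)} L^{−d} (1/i) log U(Γ_{c,x})U(c)^{−1}] U(c).» (the same display is (42) of Sect. B, p.23) — the
one-step covariant averaging; B7 p.19 (11) «(Ū^u)(y, y′) = u(y)Ū(y, y′)u^{−1}(y′), or Ū^u = (Ū)^u.» — its gauge
covariance (verbatim spans XREAD-verified in the headers of node 5 `Beta.AveragingContours` / node 7a
`Beta.AveragingHessianKernels`, whose letter lists `loopC` = `Γ_{c,x} ∪ (−c)` and `segUp` = `c` are used BY NAME);
B9 p.393 (before (3.17)) «… A^λ = A − Dλ» — the linearised gauge action (node 10's header carries the span).  READING,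
not a quotation (β-lead RULING (R25-2), node 7a): the PRODUCT CHART `U_f = X_f E_f`, fluctuation `X_f` on the LEFT of
the background `E_f`; a backward bond carries the inverse transporter.

THE IDEA.  Nodes 7b / 8b / 10 certify jets ANALYTICALLY (`=o[𝓝 0]` two-jets in a complete normed algebra); a
third-order analytic jet of (42) in that style is out of reach.  Here the jets are made EXACT instead: adjoin to the
colour algebra `𝔸` CENTRAL formal parameters with SQUARE ZERO — `τ₁`, `τ₂` (two background directions `B`, `B′`) and
`ρ` (the fluctuation): `Tau 𝔸 = 𝔸[τ₁, τ₂]`, `Rho 𝔸 = (Tau 𝔸)[ρ]` (nested `DualNumber`s, §2).  The bond variables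
`U_f = (1 + ρ ω̂_f) · e^{τ₁ B_f} e^{τ₂ B′_f}` (`Gf`; `Ebg_eq_expT`) are then polynomial, with honest two-sided inverses
(`Gb`, `Gf_mul_Gb`, `Gb_mul_Gf`), and the averaging (15)/(42), written with the cubic truncations `expT`, `logT`,
`invT` of the exponential, logarithmic and geometric series (§1), is a polynomial map `PhiG` (§3) on transporter
assignments along node 5's letter lists, read as words in the FREE abelian group on oriented letters (`LetterGrp`,
`δ`, `holG`).  (Informal: the augmentation ideal `𝔪 = (τ₁, τ₂, ρ)` of `Rho 𝔸` has `𝔪⁴ = 0`, so on `1 + 𝔪` the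
truncations ARE the full series; what is USED below is only their naturality, their conjugation-equivariance and
`g · invT g = 1 − (g − 1)⁴`.)  Two structural facts drive everything:
 * the gauge covariance (11) holds EXACTLY — `PhiG_gauge : Φ(G^u) = u(c₋) · Φ(G) · ū(c₊)` for every site function
   `u` with two-sided inverse `ū`, in ANY ring, by telescoping along the lists and conjugation-equivariance of the
   truncated series (no smallness, no commutativity, no nilpotency);
 * NATURALITY `map_PhiG` under `𝕜`-algebra maps: every identification below is obtained by projecting `Rho 𝔸` onto
   a smaller parameter ring in which the computation is first- or second-order BCH along a list.
The `(B,B′)`-POLARISED AVERAGED JET is `Qjet ω̂ B B′ :=` the `ρ`-component of `logT( Φ(ω̂) · Φ(0)⁻¹ ) ∈ Tau 𝔸` (§4;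
right-trivialised by the pure-background averaging, as node 7b's THEOREM B).  For an `𝔸`-valued fluctuation `W`
(`upF W`) its four components `c00, c10, c01, c11` — the coefficients of `1, τ₁, τ₂, τ₁τ₂` — are the jets `T₀(W)`,
`T₁(W; B)`, `T₁(W; B′)` and the ORDERED SECOND POLARISATION `T₂ᵒ(W; B, B′) := ∂_{τ₁}∂_{τ₂} T(W; e^{τ₁B} e^{τ₂B′})`
of the background dependence of the linearised averaging — `T₂ᵒ` is THE DEFINITION of the third jet in this file.

DICTIONARY to the symmetric normalisation (informal, NOT typed).  With `T(W; B)` the `t²`-Taylor coefficient of the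
linearised averaging at background `e^{tB}` (the «third jet T₂» of the β-lead's ORDER (R29-9)/(D-i)):
`T₂ᵒ(W; B, B) = 2·T(W; B)` (since `e^{τ₁B}e^{τ₂B} = e^{(τ₁+τ₂)B}`); the symmetric part `½(T₂ᵒ(W;B,B′) + T₂ᵒ(W;B′,B))`
is the polarisation `T(B+B′) − T(B) − T(B′)` (=: `T₂ᵖᵒˡ`, the object of the engines below); the antisymmetric part is
fixed by BCH, `e^{τ₁B}e^{τ₂B′} = e^{τ₁B + τ₂B′ + ½τ₁τ₂[B,B′]}`: `T₂ᵒ(W;B,B′) − T₂ᵒ(W;B′,B) = T₁(W; [B,B′])`.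

WHAT IS PROVED (all [folklore], sorry-free; `𝕜` any field, `𝔸` any ring with `Algebra 𝕜 𝔸` unless said):
§1 `expT` / `logT` / `invT`; naturality `map_expT` / `map_logT` / `map_invT` under `→ₐ[𝕜]`; conjugation-equivariance
   `expT_conj` / `logT_conj` / `invT_conj`; `mul_invT` / `invT_mul` (`g · invT g = 1 − (g−1)⁴`); then SEALED (see the
   PERF note).
§2 the rings `Tau 𝔸`, `Rho 𝔸`: components `c00 c10 c01 c11`, `mk`, `ext4`, the multiplication table, the central
   elements `τ₁ τ₂ τ12`, the embedding `ι`, the augmentation `Tau.aug`; dual-number helpers `dmk`, `mapDual`,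
   `scaleDual`, `mergeDual` (the `𝕜`-algebra maps used for naturality arguments).
§3 the free letter group `LetterGrp d`, `δ`; realisation `realize` / `holG` of node 5's lists as ordered products
   (a backward letter realises the backward transporter); gauge actions `gaugeF` / `gaugeB`; telescoping along
   `segUp` / `gammaC` / `loopC` (`tel_loopC`, `tel_cSeg`); the averaging **`PhiG`**, `map_PhiG`, `PhiG_one`, and the
   MOTHER IDENTITY **`PhiG_gauge`**; then `holG`, `PhiG` SEALED.
§4 the chart: `Ebg B B′ = (1 + τ₁ιB)(1 + τ₂ιB′) = e^{τ₁B}e^{τ₂B′}` (`Ebg_eq_expT`), `Ebi = Ebg⁻¹`, `Gf` / `Gb`, `PhiR`,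
   `augR_PhiR = 1` (`Φ ≡ 1` modulo the parameters), `PhiR_mul_invT` / `invT_mul_PhiR`; **`Qjet`** and its LINEARITY in
   the fluctuation — `Qjet_add` / `Qjet_neg` / `Qjet_sub` / `Qjet_smul` / `Qjet_zero` (naturality along `mergeDual`,
   which merges two fluctuation parameters into one, and `scaleDual`) — and `Qjet_mul_central` (homogeneity under the
   central `τ₁`, `τ₂`, `τ₁τ₂`).
§5 WARD: the infinitesimal gauge function `uG λ = 1 + ρ λ`, `ubG λ = 1 − ρ λ`; on the zero-fluctuation chart the gauge
   transform IS the chart with fluctuation `wU λ` (`gaugeF_Gf_zero`, `gaugeB_Gb_zero`), and **`wU_apply`**: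
   `wU λ = −(ι ∇λ + τ₁ ι[B,λ₊] + τ₂ ι[B′,λ₊] + τ₁τ₂ ι[B,[B′,λ₊]])` (node 5 `grad`, node 10 `gmode1`, and `gmode2o` with
   `gmode2o B B = gmode2two B`); `PhiR_wU` (the mother identity on the chart); **`Qjet_wU`**: `λ(c₋) = λ(c₊) = 0 ⇒
   Qjet (wU λ) B B′ = 0`; expanded by linearity, **`ward`**:
       `c11 Qjet(∇λ) + c01 Qjet([B,λ₊]) + c10 Qjet([B′,λ₊]) + c00 Qjet([B,[B′,λ₊]]) = 0`     (`λ(c₋) = λ(c₊) = 0`),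
   and `ward_Tau` (all four components at once).
§6 ORDER `B⁰`: **`c00_Qjet`**: `c00 (Qjet (upF W) B B′) = L^{−d} • linAvg W` (`L ≠ 0` in `𝕜`; projection to
   `DualNumber 𝔸`, where holonomies are `1 + σ Σ_ℓ W`: `holG_X1`, `PhiG_X1`; node 7b's `sum_box_sum_loopC` re-proved
   over any additive group, additively, as `sum_box_sum_loopC_add`).
§7 ORDER `B¹`: **`c10_Qjet`**: `c10 (Qjet (upF W) B B′) = (2L^{2d})⁻¹ • vhU W B` and **`c01_Qjet`**: `c01 (…) =
   (2L^{2d})⁻¹ • vhU W B′` (`2, L ≠ 0` in `𝕜`): via the projections `piB`, `piB′ : Rho 𝔸 →ₐ Tau 𝔸` onto ONE background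
   parameter, where the augmentation ideal has cube zero and the holonomy logarithm is SECOND-ORDER BCH —
   **`hol_cross`**: `2·(hol ℓ)_{σρ} − (Σ_ℓB·Σ_ℓW + Σ_ℓW·Σ_ℓB) = Σ_ℓ [W,B] + cross_ℓ(W,B)` with node 7a's POLARISED
   `cross` — after which (42) assembles to node 7a's `vhU` verbatim (`c11_logT_PhiY`).  This re-derives node 7b's
   identification «V = vhU / (2L^{2d})» by pure algebra, in the two-parameter setting.  COROLLARY **`ward_vhU`** (and
   `ward_vhU_of_base` in node 11's `𝔫_ev` convention `∀ y, λ(L•y) = 0`):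
       `T₂ᵒ(∇λ; B, B′) = −(2L^{2d})⁻¹ • (vhU([B,λ₊]; B′) + vhU([B′,λ₊]; B)) − L^{−d} • linAvg [B,[B′,λ₊]]`   (λ ∈ 𝔫_ev)
   — the order-`B²` letter of «Q_Bal(B) ∘ D_B = 0 on 𝔫_ev» (node 10's (B²), node 11's NOT-PROVED list) for THIS `T₂`.

CERTIFICATES OUTSIDE LEAN (engine tables; NOT claims of this file).  The closed form of `T₂ᵒ` as explicit ordered letter
functionals (triple sums over node 5's lists) is NOT typed.  An independent exact engine (free associative algebra over
`ℚ` on bond letters, contours and `linAvg` / `hessU` / `vhU` transcribed from the Lean definitions; `engine_t2.py`,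
sha256[:16] `165c5d101b22a418`, pub-balaban HOME `b2b-balaban-beta-an1-g13/`) expands (42) and checks, on five small
instances `(d,L) ∈ {(1,2),(1,3),(2,2)}` (82/82 PASS, `engine_small.out`) and on larger ones (kit job `j067323`, tag
`balaban-beta`; `(2,2,1,(1,−1))` passed, larger instances running at filing time): (C1) the order-`B⁰`/`B¹`
identifications above; (C2) `T₂ᵖᵒˡ(W;B,B) = 2·T(W;B)` against lit3's independent Taylor engine; (C3/E5) the
SYMMETRISED form of `ward_vhU`, `2L^{2d}·T₂ᵖᵒˡ(∇λ;B,B′) = −(vhU([B,λ₊];B′) + vhU([B′,λ₊];B) + L^d·linAvg([B,[B′,λ₊]] +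
[B′,[B,λ₊]]))` on `𝔫_ev`, refused without the `T₂` term (C3-NEG), and lit3's (E6) for general `λ`; (C4) `T₂ᵖᵒˡ` is a Lie
polynomial with `B ↔ B′`-symmetric rational kernel (`alpha_tables.json`); (C6) the one-letter BCH
`log(e^W e^B) = B + W − ½[B,W] + 1⁄12[B,[B,W]]` to order `(W¹, B²)`; and (TWO-ENGINE DIFF, `diff_lit3.out`) the
exact word tables `B0 = L^d·c₁₀`, `B1 = 2L^{2d}·c₁₁`, `B2 = 2L^{2d}·c₁₂ = L^{2d}·T₂ᵒ(W;B,B)` agree WORD BY WORD with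
lit3-g21's independently pre-registered tables on all four instances `(1,2,0,(0))`, `(1,3,0,(1))`, `(2,2,0,(0,0))`,
`(2,2,1,(0,−1))` (12/12; 2/2/3, 3/6/13, 6/72/450, 10/200/2896 words).  These concern the UNTYPED closed form only.

NOT PROVED, NOT CLAIMED: any closed-form kernel of `T₂` beyond its definition as a component of `Qjet`; the
symmetric/antisymmetric dictionary above; convergence, analyticity, or an `o(t³)` remainder for the genuine
(Banach-algebra) averaging — the link «formal jet = Taylor coefficient of the analytic map» is NOT typed here (nodes
7b / 8b own the analytic TWO-jets; no analytic third jet is in the tree); (11)/(15) for the block-rotated averagings of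
B9 (3.113); anything about gauge slices, Faddeev–Popov factors, determinants, or `BetaPertH`.  The β-lead's ORDER
(R29-9)/(D-i) (journal, 2026-08-19) naming «the T₂ letters and the (B²) Ward identity on 𝔫_ev» is the TRIGGER of this
leaf — a journal event, not a source; nothing of it is asserted here.

PERF / SEALING NOTE.  `expT`, `logT`, `invT` (after §1) and `holG`, `PhiG` (after §3) are made `irreducible` once their
API is proved: definitional unfolding of cubic polynomials evaluated on three-level pairs makes unification diverge
(`whnf` time-outs on goals that close by one `rw`).  All later proofs use the API, the equation lemmas (`rw [PhiG]`,
`simp [logT, h]`) and naturality.  `AveragingHessianKernels.comm` is always written qualified (`_root_.comm` exists).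

Provenance: pub-balaban β sub-cell, ANALYSIS PROVER AN1 lineage (gen 13, node 12 AVERAGING-THIRD-JET).  Imports node 10
`Beta.AveragingGaugeModes` (⇒ nodes 8, 7b, 7a, 6, 5) and `Mathlib.Algebra.DualNumber`.  v1.  NOT summit progress.
-/

namespace Literature.MathematicalPhysics.QuantumFieldTheory.Balaban1983to89.Beta.AveragingThirdJet

open Finset
open Literature.MathematicalPhysics.QuantumFieldTheory.Balaban1983to89.Beta.AffineAveraging
open Literature.MathematicalPhysics.QuantumFieldTheory.Balaban1983to89.Beta.AveragingContours
open Literature.MathematicalPhysics.QuantumFieldTheory.Balaban1983to89.Beta.TransportedContourVariables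
open Literature.MathematicalPhysics.QuantumFieldTheory.Balaban1983to89.Beta.AveragingHessianKernels
open Literature.MathematicalPhysics.QuantumFieldTheory.Balaban1983to89.Beta.AveragingGaugeModes

noncomputable section

/-! ## §1 The truncated exponential calculus (`Trunc`): `expT`, `logT`, `invT`, naturality, conjugation -/

section Trunc

variable (𝕜 : Type*) [Field 𝕜] {R R' : Type*} [Ring R] [Algebra 𝕜 R] [Ring R'] [Algebra 𝕜 R']

/-- [folklore] The exponential series truncated after the cubic term: `1 + x + x²/2 + x³/6`. -/
def expT (x : R) : R := 1 + x + (2 : 𝕜)⁻¹ • (x * x) + (6 : 𝕜)⁻¹ • (x * x * x)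

/-- [folklore] The logarithmic series at `1` truncated after the cubic term: `n − n²/2 + n³/3`, `n = g − 1`. -/
def logT (g : R) : R :=
  (g - 1) - (2 : 𝕜)⁻¹ • ((g - 1) * (g - 1)) + (3 : 𝕜)⁻¹ • ((g - 1) * (g - 1) * (g - 1))

variable {𝕜}

/-- [folklore] The geometric (inverse) series at `1` truncated after the cubic term: `1 − n + n² − n³`, `n = g − 1`. -/
def invT (g : R) : R := 1 - (g - 1) + (g - 1) * (g - 1) - (g - 1) * (g - 1) * (g - 1)

/-- [folklore] `expT 0 = 1`. -/
@[simp] theorem expT_zero : expT 𝕜 (0 : R) = 1 := by simp [expT]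

/-- [folklore] `logT 1 = 0`. -/
@[simp] theorem logT_one : logT 𝕜 (1 : R) = 0 := by simp [logT]

/-- [folklore] `invT 1 = 1`. -/
@[simp] theorem invT_one : invT (1 : R) = 1 := by simp [invT]

/-- [folklore] Naturality of `expT` under `𝕜`-algebra maps. -/
theorem map_expT (φ : R →ₐ[𝕜] R') (x : R) : φ (expT 𝕜 x) = expT 𝕜 (φ x) := by
  simp only [expT, map_add, map_one, map_mul, map_smul]

/-- [folklore] Naturality of `logT` under `𝕜`-algebra maps. -/
theorem map_logT (φ : R →ₐ[𝕜] R') (g : R) : φ (logT 𝕜 g) = logT 𝕜 (φ g) := by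
  simp only [logT, map_add, map_sub, map_one, map_mul, map_smul]

/-- [folklore] Naturality of `invT` under `𝕜`-algebra maps. -/
theorem map_invT (φ : R →ₐ[𝕜] R') (g : R) : φ (invT g) = invT (φ g) := by
  simp only [invT, map_add, map_sub, map_one, map_mul]

/-- [folklore] `g · invT g = 1 − (g − 1)⁴`: the truncated geometric series inverts exactly modulo fourth powers. -/
theorem mul_invT (g : R) : g * invT g = 1 - (g - 1) * (g - 1) * (g - 1) * (g - 1) := by
  simp only [invT]; noncomm_ring

/-- [folklore] `invT g · g = 1 − (g − 1)⁴`. -/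
theorem invT_mul (g : R) : invT g * g = 1 - (g - 1) * (g - 1) * (g - 1) * (g - 1) := by
  simp only [invT]; noncomm_ring

section Conj

variable {u v : R}

/-- [folklore] Conjugation by a unit pair is multiplicative. -/
theorem conj_mul_conj (hvu : v * u = 1) (a b : R) : u * a * v * (u * b * v) = u * (a * b) * v := by
  calc u * a * v * (u * b * v) = u * a * (v * u) * b * v := by simp only [mul_assoc]
    _ = u * (a * b) * v := by rw [hvu]; simp only [mul_one, mul_assoc]

/-- [folklore] `expT` is conjugation-equivariant: `expT (u x v) = u (expT x) v` for `u v = v u = 1`. -/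
theorem expT_conj (huv : u * v = 1) (hvu : v * u = 1) (x : R) :
    expT 𝕜 (u * x * v) = u * expT 𝕜 x * v := by
  simp only [expT]
  rw [conj_mul_conj hvu x x, conj_mul_conj hvu (x * x) x]
  simp only [mul_add, add_mul, mul_one, huv, mul_smul_comm, smul_mul_assoc]

/-- [folklore] `logT` is conjugation-equivariant: `logT (u g v) = u (logT g) v` for `u v = v u = 1`. -/
theorem logT_conj (huv : u * v = 1) (hvu : v * u = 1) (g : R) :
    logT 𝕜 (u * g * v) = u * logT 𝕜 g * v := by
  have h1 : u * g * v - 1 = u * (g - 1) * v := by rw [mul_sub, sub_mul, mul_one, huv]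
  simp only [logT]
  rw [h1]
  generalize g - 1 = n
  rw [conj_mul_conj hvu n n, conj_mul_conj hvu (n * n) n]
  simp only [mul_add, add_mul, mul_sub, sub_mul, mul_smul_comm, smul_mul_assoc]

/-- [folklore] `invT` is conjugation-equivariant. -/
theorem invT_conj (huv : u * v = 1) (hvu : v * u = 1) (g : R) :
    invT (u * g * v) = u * invT g * v := by
  have h1 : u * g * v - 1 = u * (g - 1) * v := by rw [mul_sub, sub_mul, mul_one, huv]
  simp only [invT]
  rw [h1]
  generalize g - 1 = n
  rw [conj_mul_conj hvu n n, conj_mul_conj hvu (n * n) n]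
  simp only [mul_add, add_mul, mul_sub, sub_mul, mul_one, huv]

end Conj

/- From here on the truncated series are handled ONLY through their API lemmas and equation lemmas: unfolding
them definitionally inside the nested jet rings below makes unification explode (measured), so they are sealed. -/
attribute [irreducible] expT logT invT

end Trunc

/-! ## §2 The formal parameter rings `Tau 𝔸 = 𝔸[τ₁, τ₂]` and `Rho 𝔸 = 𝔸[τ₁, τ₂, ρ]` (squares zero) -/

section Rings

variable {𝕜 : Type*} [Field 𝕜] (𝔸 : Type*) [Ring 𝔸] [Algebra 𝕜 𝔸]

/-- [folklore] `Tau 𝔸 := 𝔸[τ₁][τ₂]`, `τ₁² = τ₂² = 0`, both central: the nested dual numbers. An element is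
`q = c00 q + τ₁·c10 q + τ₂·c01 q + τ₁τ₂·c11 q`. -/
abbrev Tau := DualNumber (DualNumber 𝔸)

/-- [folklore] `Rho 𝔸 := (Tau 𝔸)[ρ]`, `ρ² = 0`, central: an element is `(a, m) = a + ρ·m`, `a m : Tau 𝔸`. -/
abbrev Rho := DualNumber (Tau 𝔸)

variable {𝔸}

namespace Tau

/-- [folklore] The four components of `q : Tau 𝔸`. -/
def c00 (q : Tau 𝔸) : 𝔸 := q.fst.fst
/-- [folklore] The `τ₁`-component. -/
def c10 (q : Tau 𝔸) : 𝔸 := q.fst.snd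
/-- [folklore] The `τ₂`-component. -/
def c01 (q : Tau 𝔸) : 𝔸 := q.snd.fst
/-- [folklore] The `τ₁τ₂`-component. -/
def c11 (q : Tau 𝔸) : 𝔸 := q.snd.snd

/-- [folklore] The element with prescribed components. -/
def mk (a b c e : 𝔸) : Tau 𝔸 := ((a, b), (c, e))

omit [Ring 𝔸] in
/-- [folklore] The `c00` component of `mk` (by `rfl`). -/
@[simp] theorem c00_mk (a b c e : 𝔸) : c00 (mk a b c e) = a := rfl
omit [Ring 𝔸] in
/-- [folklore] The `c10` component of `mk` (by `rfl`). -/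
@[simp] theorem c10_mk (a b c e : 𝔸) : c10 (mk a b c e) = b := rfl
omit [Ring 𝔸] in
/-- [folklore] The `c01` component of `mk` (by `rfl`). -/
@[simp] theorem c01_mk (a b c e : 𝔸) : c01 (mk a b c e) = c := rfl
omit [Ring 𝔸] in
/-- [folklore] The `c11` component of `mk` (by `rfl`). -/
@[simp] theorem c11_mk (a b c e : 𝔸) : c11 (mk a b c e) = e := rfl

omit [Ring 𝔸] in
/-- [folklore] Extensionality for `Tau 𝔸` through its four components. -/
theorem ext4 {p q : Tau 𝔸} (h0 : c00 p = c00 q) (h1 : c10 p = c10 q) (h2 : c01 p = c01 q)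
    (h3 : c11 p = c11 q) : p = q :=
  TrivSqZeroExt.ext (TrivSqZeroExt.ext h0 h1) (TrivSqZeroExt.ext h2 h3)

omit [Ring 𝔸] in
/-- [folklore] Reconstruction of an element of `Tau 𝔸` from its four components. -/
theorem mk_eq (q : Tau 𝔸) : mk (c00 q) (c10 q) (c01 q) (c11 q) = q := ext4 rfl rfl rfl rfl

variable (p q : Tau 𝔸)

/-- [folklore] The `c00` component of a product in `Tau 𝔸`. -/
@[simp] theorem c00_mul : c00 (p * q) = c00 p * c00 q := rfl
/-- [folklore] The `c10` component of a product in `Tau 𝔸`. -/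
@[simp] theorem c10_mul : c10 (p * q) = c00 p * c10 q + c10 p * c00 q := rfl
/-- [folklore] The `c01` component of a product in `Tau 𝔸`. -/
@[simp] theorem c01_mul : c01 (p * q) = c00 p * c01 q + c01 p * c00 q := rfl
/-- [folklore] The `c11` component of a product in `Tau 𝔸`. -/
@[simp] theorem c11_mul : c11 (p * q) = c00 p * c11 q + c10 p * c01 q + (c01 p * c10 q + c11 p * c00 q) := rfl
/-- [folklore] The `c00` component of a sum. -/
@[simp] theorem c00_add : c00 (p + q) = c00 p + c00 q := rfl
/-- [folklore] The `c10` component of a sum. -/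
@[simp] theorem c10_add : c10 (p + q) = c10 p + c10 q := rfl
/-- [folklore] The `c01` component of a sum. -/
@[simp] theorem c01_add : c01 (p + q) = c01 p + c01 q := rfl
/-- [folklore] The `c11` component of a sum. -/
@[simp] theorem c11_add : c11 (p + q) = c11 p + c11 q := rfl
/-- [folklore] The `c00` component of a difference. -/
@[simp] theorem c00_sub : c00 (p - q) = c00 p - c00 q := rfl
/-- [folklore] The `c10` component of a difference. -/
@[simp] theorem c10_sub : c10 (p - q) = c10 p - c10 q := rfl
/-- [folklore] The `c01` component of a difference. -/
@[simp] theorem c01_sub : c01 (p - q) = c01 p - c01 q := rfl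
/-- [folklore] The `c11` component of a difference. -/
@[simp] theorem c11_sub : c11 (p - q) = c11 p - c11 q := rfl
/-- [folklore] The `c00` component of a negation. -/
@[simp] theorem c00_neg : c00 (-p) = -c00 p := rfl
/-- [folklore] The `c10` component of a negation. -/
@[simp] theorem c10_neg : c10 (-p) = -c10 p := rfl
/-- [folklore] The `c01` component of a negation. -/
@[simp] theorem c01_neg : c01 (-p) = -c01 p := rfl
/-- [folklore] The `c11` component of a negation. -/
@[simp] theorem c11_neg : c11 (-p) = -c11 p := rfl
/-- [folklore] The `c00` component of `0`. -/
@[simp] theorem c00_zero : c00 (0 : Tau 𝔸) = 0 := rfl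
/-- [folklore] The `c10` component of `0`. -/
@[simp] theorem c10_zero : c10 (0 : Tau 𝔸) = 0 := rfl
/-- [folklore] The `c01` component of `0`. -/
@[simp] theorem c01_zero : c01 (0 : Tau 𝔸) = 0 := rfl
/-- [folklore] The `c11` component of `0`. -/
@[simp] theorem c11_zero : c11 (0 : Tau 𝔸) = 0 := rfl
/-- [folklore] The `c00` component of `1`. -/
@[simp] theorem c00_one : c00 (1 : Tau 𝔸) = 1 := rfl
/-- [folklore] The `c10` component of `1`. -/
@[simp] theorem c10_one : c10 (1 : Tau 𝔸) = 0 := rfl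
/-- [folklore] The `c01` component of `1`. -/
@[simp] theorem c01_one : c01 (1 : Tau 𝔸) = 0 := rfl
/-- [folklore] The `c11` component of `1`. -/
@[simp] theorem c11_one : c11 (1 : Tau 𝔸) = 0 := rfl
/-- [folklore] The `c00` component of a scalar multiple. -/
@[simp] theorem c00_smul (r : 𝕜) : c00 (r • p) = r • c00 p := rfl
/-- [folklore] The `c10` component of a scalar multiple. -/
@[simp] theorem c10_smul (r : 𝕜) : c10 (r • p) = r • c10 p := rfl
/-- [folklore] The `c01` component of a scalar multiple. -/
@[simp] theorem c01_smul (r : 𝕜) : c01 (r • p) = r • c01 p := rfl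
/-- [folklore] The `c11` component of a scalar multiple. -/
@[simp] theorem c11_smul (r : 𝕜) : c11 (r • p) = r • c11 p := rfl
/-- [folklore] The components as additive maps. -/
def c00Hom : Tau 𝔸 →+ 𝔸 where
  toFun := c00
  map_zero' := rfl
  map_add' _ _ := rfl
/-- [folklore] -/
def c10Hom : Tau 𝔸 →+ 𝔸 where
  toFun := c10
  map_zero' := rfl
  map_add' _ _ := rfl
/-- [folklore] -/
def c01Hom : Tau 𝔸 →+ 𝔸 where
  toFun := c01
  map_zero' := rfl
  map_add' _ _ := rfl
/-- [folklore] -/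
def c11Hom : Tau 𝔸 →+ 𝔸 where
  toFun := c11
  map_zero' := rfl
  map_add' _ _ := rfl

/-- [folklore] The `c00` component of a finite sum. -/
@[simp] theorem c00_sum {ι : Type*} (s : Finset ι) (f : ι → Tau 𝔸) :
    c00 (∑ i ∈ s, f i) = ∑ i ∈ s, c00 (f i) := map_sum c00Hom f s
/-- [folklore] The `c10` component of a finite sum. -/
@[simp] theorem c10_sum {ι : Type*} (s : Finset ι) (f : ι → Tau 𝔸) :
    c10 (∑ i ∈ s, f i) = ∑ i ∈ s, c10 (f i) := map_sum c10Hom f s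
/-- [folklore] The `c01` component of a finite sum. -/
@[simp] theorem c01_sum {ι : Type*} (s : Finset ι) (f : ι → Tau 𝔸) :
    c01 (∑ i ∈ s, f i) = ∑ i ∈ s, c01 (f i) := map_sum c01Hom f s
/-- [folklore] The `c11` component of a finite sum. -/
@[simp] theorem c11_sum {ι : Type*} (s : Finset ι) (f : ι → Tau 𝔸) :
    c11 (∑ i ∈ s, f i) = ∑ i ∈ s, c11 (f i) := map_sum c11Hom f s

/-- [folklore] The generators `τ₁ = (ε, 0)`, `τ₂ = (0, 1)`, their product `τ₁τ₂ = (0, ε)`, and the scalars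
`ι a = ((a, 0), (0, 0))`. -/
def τ₁ : Tau 𝔸 := mk 0 1 0 0
/-- [folklore] -/
def τ₂ : Tau 𝔸 := mk 0 0 1 0
/-- [folklore] -/
def τ12 : Tau 𝔸 := mk 0 0 0 1
/-- [folklore] -/
def ι (a : 𝔸) : Tau 𝔸 := mk a 0 0 0

/-- [folklore] The `c00` component of `τ₁`. -/
@[simp] theorem c00_τ₁ : c00 (τ₁ : Tau 𝔸) = 0 := rfl
/-- [folklore] The `c10` component of `τ₁`. -/
@[simp] theorem c10_τ₁ : c10 (τ₁ : Tau 𝔸) = 1 := rfl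
/-- [folklore] The `c01` component of `τ₁`. -/
@[simp] theorem c01_τ₁ : c01 (τ₁ : Tau 𝔸) = 0 := rfl
/-- [folklore] The `c11` component of `τ₁`. -/
@[simp] theorem c11_τ₁ : c11 (τ₁ : Tau 𝔸) = 0 := rfl
/-- [folklore] The `c00` component of `τ₂`. -/
@[simp] theorem c00_τ₂ : c00 (τ₂ : Tau 𝔸) = 0 := rfl
/-- [folklore] The `c10` component of `τ₂`. -/
@[simp] theorem c10_τ₂ : c10 (τ₂ : Tau 𝔸) = 0 := rfl
/-- [folklore] The `c01` component of `τ₂`. -/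
@[simp] theorem c01_τ₂ : c01 (τ₂ : Tau 𝔸) = 1 := rfl
/-- [folklore] The `c11` component of `τ₂`. -/
@[simp] theorem c11_τ₂ : c11 (τ₂ : Tau 𝔸) = 0 := rfl
/-- [folklore] The `c00` component of `τ₁τ₂`. -/
@[simp] theorem c00_τ12 : c00 (τ12 : Tau 𝔸) = 0 := rfl
/-- [folklore] The `c10` component of `τ₁τ₂`. -/
@[simp] theorem c10_τ12 : c10 (τ12 : Tau 𝔸) = 0 := rfl
/-- [folklore] The `c01` component of `τ₁τ₂`. -/
@[simp] theorem c01_τ12 : c01 (τ12 : Tau 𝔸) = 0 := rfl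
/-- [folklore] The `c11` component of `τ₁τ₂`. -/
@[simp] theorem c11_τ12 : c11 (τ12 : Tau 𝔸) = 1 := rfl
/-- [folklore] The `c00` component of `ι a`. -/
@[simp] theorem c00_ι (a : 𝔸) : c00 (ι a) = a := rfl
/-- [folklore] The `c10` component of `ι a`. -/
@[simp] theorem c10_ι (a : 𝔸) : c10 (ι a) = 0 := rfl
/-- [folklore] The `c01` component of `ι a`. -/
@[simp] theorem c01_ι (a : 𝔸) : c01 (ι a) = 0 := rfl
/-- [folklore] The `c11` component of `ι a`. -/
@[simp] theorem c11_ι (a : 𝔸) : c11 (ι a) = 0 := rfl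

/-- [folklore] Multiplication table of the central elements: `τ₁ · τ₂`. -/
theorem τ₁_mul_τ₂ : (τ₁ * τ₂ : Tau 𝔸) = τ12 := ext4 (by simp) (by simp) (by simp) (by simp)
/-- [folklore] Multiplication table of the central elements: `τ₂ · τ₁`. -/
theorem τ₂_mul_τ₁ : (τ₂ * τ₁ : Tau 𝔸) = τ12 := ext4 (by simp) (by simp) (by simp) (by simp)
/-- [folklore] Multiplication table of the central elements: `τ₁ · τ₁`. -/
@[simp] theorem τ₁_mul_τ₁ : (τ₁ * τ₁ : Tau 𝔸) = 0 := ext4 (by simp) (by simp) (by simp) (by simp)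
/-- [folklore] Multiplication table of the central elements: `τ₂ · τ₂`. -/
@[simp] theorem τ₂_mul_τ₂ : (τ₂ * τ₂ : Tau 𝔸) = 0 := ext4 (by simp) (by simp) (by simp) (by simp)
/-- [folklore] Multiplication table of the central elements: `τ₁ · τ12`. -/
@[simp] theorem τ₁_mul_τ12 : (τ₁ * τ12 : Tau 𝔸) = 0 := ext4 (by simp) (by simp) (by simp) (by simp)
/-- [folklore] Multiplication table of the central elements: `τ₂ · τ12`. -/
@[simp] theorem τ₂_mul_τ12 : (τ₂ * τ12 : Tau 𝔸) = 0 := ext4 (by simp) (by simp) (by simp) (by simp)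
/-- [folklore] Multiplication table of the central elements: `τ12 · τ₁`. -/
@[simp] theorem τ12_mul_τ₁ : (τ12 * τ₁ : Tau 𝔸) = 0 := ext4 (by simp) (by simp) (by simp) (by simp)
/-- [folklore] Multiplication table of the central elements: `τ12 · τ₂`. -/
@[simp] theorem τ12_mul_τ₂ : (τ12 * τ₂ : Tau 𝔸) = 0 := ext4 (by simp) (by simp) (by simp) (by simp)
/-- [folklore] Multiplication table of the central elements: `τ12 · τ12`. -/
@[simp] theorem τ12_mul_τ12 : (τ12 * τ12 : Tau 𝔸) = 0 := ext4 (by simp) (by simp) (by simp) (by simp)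

/-- [folklore] The generators are central. -/
theorem τ₁_comm (q : Tau 𝔸) : τ₁ * q = q * τ₁ := ext4 (by simp) (by simp) (by simp) (by simp)
/-- [folklore] `τ₂` is central. -/
theorem τ₂_comm (q : Tau 𝔸) : τ₂ * q = q * τ₂ := ext4 (by simp) (by simp) (by simp) (by simp)
/-- [folklore] `τ₁τ₂` is central. -/
theorem τ12_comm (q : Tau 𝔸) : τ12 * q = q * τ12 := ext4 (by simp) (by simp) (by simp) (by simp)

/-- [folklore] The `c00` component of a left multiple of `τ₁`. -/
@[simp] theorem c00_τ₁_mul (q : Tau 𝔸) : c00 (τ₁ * q) = 0 := by simp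
/-- [folklore] The `c10` component of a left multiple of `τ₁`. -/
@[simp] theorem c10_τ₁_mul (q : Tau 𝔸) : c10 (τ₁ * q) = c00 q := by simp
/-- [folklore] The `c01` component of a left multiple of `τ₁`. -/
@[simp] theorem c01_τ₁_mul (q : Tau 𝔸) : c01 (τ₁ * q) = 0 := by simp
/-- [folklore] The `c11` component of a left multiple of `τ₁`. -/
@[simp] theorem c11_τ₁_mul (q : Tau 𝔸) : c11 (τ₁ * q) = c01 q := by simp
/-- [folklore] The `c00` component of a left multiple of `τ₂`. -/
@[simp] theorem c00_τ₂_mul (q : Tau 𝔸) : c00 (τ₂ * q) = 0 := by simp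
/-- [folklore] The `c10` component of a left multiple of `τ₂`. -/
@[simp] theorem c10_τ₂_mul (q : Tau 𝔸) : c10 (τ₂ * q) = 0 := by simp
/-- [folklore] The `c01` component of a left multiple of `τ₂`. -/
@[simp] theorem c01_τ₂_mul (q : Tau 𝔸) : c01 (τ₂ * q) = c00 q := by simp
/-- [folklore] The `c11` component of a left multiple of `τ₂`. -/
@[simp] theorem c11_τ₂_mul (q : Tau 𝔸) : c11 (τ₂ * q) = c10 q := by simp
/-- [folklore] The `c00` component of a left multiple of `τ₁τ₂`. -/
@[simp] theorem c00_τ12_mul (q : Tau 𝔸) : c00 (τ12 * q) = 0 := by simp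
/-- [folklore] The `c10` component of a left multiple of `τ₁τ₂`. -/
@[simp] theorem c10_τ12_mul (q : Tau 𝔸) : c10 (τ12 * q) = 0 := by simp
/-- [folklore] The `c01` component of a left multiple of `τ₁τ₂`. -/
@[simp] theorem c01_τ12_mul (q : Tau 𝔸) : c01 (τ12 * q) = 0 := by simp
/-- [folklore] The `c11` component of a left multiple of `τ₁τ₂`. -/
@[simp] theorem c11_τ12_mul (q : Tau 𝔸) : c11 (τ12 * q) = c00 q := by simp
/-- [folklore] The `c00` component of `ι a · q`. -/
@[simp] theorem c00_ι_mul (a : 𝔸) (q : Tau 𝔸) : c00 (ι a * q) = a * c00 q := by simp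
/-- [folklore] The `c10` component of `ι a · q`. -/
@[simp] theorem c10_ι_mul (a : 𝔸) (q : Tau 𝔸) : c10 (ι a * q) = a * c10 q := by simp
/-- [folklore] The `c01` component of `ι a · q`. -/
@[simp] theorem c01_ι_mul (a : 𝔸) (q : Tau 𝔸) : c01 (ι a * q) = a * c01 q := by simp
/-- [folklore] The `c11` component of `ι a · q`. -/
@[simp] theorem c11_ι_mul (a : 𝔸) (q : Tau 𝔸) : c11 (ι a * q) = a * c11 q := by simp
/-- [folklore] The `c00` component of `q · ι a`. -/
@[simp] theorem c00_mul_ι (a : 𝔸) (q : Tau 𝔸) : c00 (q * ι a) = c00 q * a := by simp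
/-- [folklore] The `c10` component of `q · ι a`. -/
@[simp] theorem c10_mul_ι (a : 𝔸) (q : Tau 𝔸) : c10 (q * ι a) = c10 q * a := by simp
/-- [folklore] The `c01` component of `q · ι a`. -/
@[simp] theorem c01_mul_ι (a : 𝔸) (q : Tau 𝔸) : c01 (q * ι a) = c01 q * a := by simp
/-- [folklore] The `c11` component of `q · ι a`. -/
@[simp] theorem c11_mul_ι (a : 𝔸) (q : Tau 𝔸) : c11 (q * ι a) = c11 q * a := by simp

/-- [folklore] The component decomposition `q = ι c00 + τ₁ ι c10 + τ₂ ι c01 + τ₁τ₂ ι c11`. -/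
theorem decomp (q : Tau 𝔸) : q = ι (c00 q) + τ₁ * ι (c10 q) + τ₂ * ι (c01 q) + τ12 * ι (c11 q) :=
  ext4 (by simp) (by simp) (by simp) (by simp)

/-- [folklore] NILPOTENCY: a product with three factors from the augmentation ideal `{c00 = 0}` vanishes. -/
theorem mul3_eq_zero {a b c : Tau 𝔸} (ha : c00 a = 0) (hb : c00 b = 0) (hc : c00 c = 0) : a * b * c = 0 :=
  ext4 (by simp [ha, hb]) (by simp [ha, hb, hc]) (by simp [ha, hb, hc]) (by simp [ha, hb, hc])
/-- [folklore] A product of four elements of `Tau 𝔸` with vanishing `c00` components vanishes (left grouping). -/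
theorem mul4_eq_zero_l {a b c : Tau 𝔸} (q : Tau 𝔸) (ha : c00 a = 0) (hb : c00 b = 0) (hc : c00 c = 0) :
    q * a * b * c = 0 := by rw [mul_assoc, mul_assoc, ← mul_assoc a, mul3_eq_zero ha hb hc, mul_zero]
/-- [folklore] A product of four elements of `Tau 𝔸` with vanishing `c00` components vanishes (middle grouping). -/
theorem mul4_eq_zero_m {a b c : Tau 𝔸} (q : Tau 𝔸) (ha : c00 a = 0) (hb : c00 b = 0) (hc : c00 c = 0) :
    a * q * b * c = 0 :=
  ext4 (by simp [ha, hb]) (by simp [ha, hb, hc]) (by simp [ha, hb, hc]) (by simp [ha, hb, hc])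
/-- [folklore] A product of four elements of `Tau 𝔸` with vanishing `c00` components vanishes (right grouping). -/
theorem mul4_eq_zero_r {a b c : Tau 𝔸} (q : Tau 𝔸) (ha : c00 a = 0) (hb : c00 b = 0) (hc : c00 c = 0) :
    a * b * q * c = 0 :=
  ext4 (by simp [ha, hb]) (by simp [ha, hb, hc]) (by simp [ha, hb, hc]) (by simp [ha, hb, hc])

/-- [folklore] The augmentation `c00` as a `𝕜`-algebra map. -/
def aug : Tau 𝔸 →ₐ[𝕜] 𝔸 :=
  (TrivSqZeroExt.fstHom 𝕜 𝔸 𝔸).comp (TrivSqZeroExt.fstHom 𝕜 (DualNumber 𝔸) (DualNumber 𝔸))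

/-- [folklore] Evaluation of the augmentation `Tau.aug`. -/
@[simp] theorem aug_apply (q : Tau 𝔸) : aug (𝕜 := 𝕜) q = c00 q := rfl

/-- [folklore] The scalars `ι` as a `𝕜`-algebra map. -/
def ιHom : 𝔸 →ₐ[𝕜] Tau 𝔸 where
  toFun := ι
  map_one' := rfl
  map_mul' a b := ext4 (by simp) (by simp) (by simp) (by simp)
  map_zero' := rfl
  map_add' a b := ext4 (by simp) (by simp) (by simp) (by simp)
  commutes' r := by
    refine ext4 ?_ ?_ ?_ ?_ <;>
      simp [ι, Algebra.algebraMap_eq_smul_one, c00, c10, c01, c11, mk]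

/-- [folklore] Evaluation of the embedding homomorphism `ιHom`. -/
@[simp] theorem ιHom_apply (a : 𝔸) : ιHom (𝕜 := 𝕜) a = ι a := rfl

end Tau

/-! ### Dual numbers over a ring: components, the functor `mapDual` -/

section Dual

variable {R R' : Type*} [Ring R] [Algebra 𝕜 R] [Ring R'] [Algebra 𝕜 R']

/-- [folklore] The pair constructor of `DualNumber R` (= `R × R` as a type). -/
def dmk (a m : R) : DualNumber R := (a, m)

omit [Ring R] [Algebra 𝕜 R] in
/-- [folklore] First component of `dmk`. -/
@[simp] theorem fst_dmk (a m : R) : (dmk a m).fst = a := rfl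
omit [Ring R] [Algebra 𝕜 R] in
/-- [folklore] Second component of `dmk`. -/
@[simp] theorem snd_dmk (a m : R) : (dmk a m).snd = m := rfl
omit [Algebra 𝕜 R] in
/-- [folklore] First component of a product of dual numbers. -/
theorem dfst_mul (x y : DualNumber R) : (x * y).fst = x.fst * y.fst := rfl
omit [Algebra 𝕜 R] in
/-- [folklore] Second component of a product of dual numbers (Leibniz rule). -/
theorem dsnd_mul (x y : DualNumber R) : (x * y).snd = x.fst * y.snd + x.snd * y.fst := rfl
omit [Ring R] [Algebra 𝕜 R] in
/-- [folklore] Reconstruction of a dual number from its components. -/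
theorem dmk_eq (x : DualNumber R) : dmk x.fst x.snd = x := TrivSqZeroExt.ext rfl rfl

/-- [folklore] Functoriality of dual numbers in the coefficient ring: `(a, m) ↦ (f a, f m)`. -/
def mapDual (f : R →ₐ[𝕜] R') : DualNumber R →ₐ[𝕜] DualNumber R' where
  toFun q := dmk (f q.fst) (f q.snd)
  map_one' := TrivSqZeroExt.ext (by simp) (by simp)
  map_mul' p q := TrivSqZeroExt.ext (by simp) (by simp)
  map_zero' := TrivSqZeroExt.ext (by simp) (by simp)
  map_add' p q := TrivSqZeroExt.ext (by simp) (by simp)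
  commutes' r := TrivSqZeroExt.ext (by simp [TrivSqZeroExt.algebraMap_eq_inl'])
    (by simp [TrivSqZeroExt.algebraMap_eq_inl'])

/-- [folklore] First component of `mapDual`. -/
@[simp] theorem fst_mapDual (f : R →ₐ[𝕜] R') (q : DualNumber R) : (mapDual f q).fst = f q.fst := rfl
/-- [folklore] Second component of `mapDual`. -/
@[simp] theorem snd_mapDual (f : R →ₐ[𝕜] R') (q : DualNumber R) : (mapDual f q).snd = f q.snd := rfl

/-- [folklore] Rescaling the nilpotent direction by a CENTRAL element `s`: `(a, m) ↦ (a, s m)` is an algebra map. -/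
def scaleDual (s : R) (hs : ∀ t, s * t = t * s) : DualNumber R →ₐ[𝕜] DualNumber R where
  toFun q := dmk q.fst (s * q.snd)
  map_one' := TrivSqZeroExt.ext (by simp) (by simp)
  map_mul' p q := TrivSqZeroExt.ext (by simp) (by
    simp only [snd_dmk, dsnd_mul, fst_dmk, mul_add, ← mul_assoc, hs p.fst])
  map_zero' := TrivSqZeroExt.ext (by simp) (by simp)
  map_add' p q := TrivSqZeroExt.ext (by simp) (by simp [mul_add])
  commutes' r := TrivSqZeroExt.ext (by simp)
    (by simp [TrivSqZeroExt.algebraMap_eq_inl'])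

/-- [folklore] First component of `scaleDual`. -/
@[simp] theorem fst_scaleDual (s : R) (hs : ∀ t, s * t = t * s) (q : DualNumber R) :
    (scaleDual (𝕜 := 𝕜) s hs q).fst = q.fst := rfl
/-- [folklore] Second component of `scaleDual`. -/
@[simp] theorem snd_scaleDual (s : R) (hs : ∀ t, s * t = t * s) (q : DualNumber R) :
    (scaleDual (𝕜 := 𝕜) s hs q).snd = s * q.snd := rfl

/-- [folklore] Identifying two nilpotent directions: `R[ρ][ρ′] → R[ρ]`, `((a, m), (m′, _)) ↦ (a, m + m′)`. -/
def mergeDual : DualNumber (DualNumber R) →ₐ[𝕜] DualNumber R where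
  toFun w := dmk w.fst.fst (w.fst.snd + w.snd.fst)
  map_one' := TrivSqZeroExt.ext (by simp) (by simp)
  map_mul' p q := TrivSqZeroExt.ext (by simp) (by
    simp only [snd_dmk, fst_dmk, dsnd_mul, dfst_mul, TrivSqZeroExt.fst_add, mul_add, add_mul]; abel)
  map_zero' := TrivSqZeroExt.ext (by simp) (by simp)
  map_add' p q := TrivSqZeroExt.ext (by simp) (by
    simp only [snd_dmk, TrivSqZeroExt.fst_add, TrivSqZeroExt.snd_add]; abel)
  commutes' r := TrivSqZeroExt.ext (by simp [TrivSqZeroExt.algebraMap_eq_inl'])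
    (by simp [TrivSqZeroExt.algebraMap_eq_inl'])

/-- [folklore] First component of `mergeDual`. -/
@[simp] theorem fst_mergeDual (w : DualNumber (DualNumber R)) : (mergeDual (𝕜 := 𝕜) w).fst = w.fst.fst := rfl
/-- [folklore] Second component of `mergeDual`. -/
@[simp] theorem snd_mergeDual (w : DualNumber (DualNumber R)) :
    (mergeDual (𝕜 := 𝕜) w).snd = w.fst.snd + w.snd.fst := rfl

end Dual

end Rings

/-! ## §3 Free oriented letters, group-valued transporters along node 5's contours, gauge telescoping -/

section Letters

variable {𝕜 : Type*} [Field 𝕜] {d : ℕ} {R R' : Type*} [Ring R] [Algebra 𝕜 R] [Ring R'] [Algebra 𝕜 R']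

/-- [folklore] THE FREE LETTER GROUP: formal `ℤ`-combinations of bonds `(κ, x)`. -/
abbrev LetterGrp (d : ℕ) : Type := (Fin d × (Fin d → ℤ)) →₀ ℤ

/-- [folklore] THE UNIVERSAL ONE-FORM: the bond `(κ, x)` ↦ its generator. Node 5's contour combinators applied to
`δ` produce lists of ORIENTED BONDS (`δ κ x` forward, `−δ κ x` backward). -/
def δ : Form1 d (LetterGrp d) := fun κ x => Finsupp.single (κ, x) 1

/-- [folklore] REALISATION of an oriented bond by a pair of transporters: `G` on forward bonds, `Ḡ` on backward
bonds (any other letter ↦ `0`; only `±δ` occur). -/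
def realize (G Gb : Form1 d R) (v : LetterGrp d) : R :=
  ∑ f ∈ v.support, if v f = 1 then G f.1 f.2 else if v f = -1 then Gb f.1 f.2 else 0

omit [Algebra 𝕜 R] in
/-- [folklore] A forward letter realises the forward transporter. -/
@[simp] theorem realize_delta (G Gb : Form1 d R) (κ : Fin d) (x : Fin d → ℤ) : realize G Gb (δ κ x) = G κ x := by
  simp [realize, δ]

omit [Algebra 𝕜 R] in
/-- [folklore] A backward letter realises the backward transporter. -/
@[simp] theorem realize_neg_delta (G Gb : Form1 d R) (κ : Fin d) (x : Fin d → ℤ) :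
    realize G Gb (-δ κ x) = Gb κ x := by
  simp [realize, δ, ← Finsupp.single_neg]

/-- [folklore] Naturality of `realize`. -/
theorem map_realize (φ : R →ₐ[𝕜] R') (G Gb : Form1 d R) (v : LetterGrp d) :
    φ (realize G Gb v) = realize (fun κ x => φ (G κ x)) (fun κ x => φ (Gb κ x)) v := by
  simp only [realize, map_sum]
  refine Finset.sum_congr rfl fun f _ => ?_
  split_ifs <;> simp

/-- [folklore] THE GROUP-VALUED TRANSPORTER along a list of oriented bonds: the ordered product of realisations. -/
def holG (G Gb : Form1 d R) (l : List (LetterGrp d)) : R := (l.map (realize G Gb)).prod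

omit [Algebra 𝕜 R] in
/-- [folklore] The transporter along the empty list is `1`. -/
@[simp] theorem holG_nil (G Gb : Form1 d R) : holG G Gb [] = 1 := rfl

omit [Algebra 𝕜 R] in
/-- [folklore] The transporter along `a :: l`. -/
@[simp] theorem holG_cons (G Gb : Form1 d R) (a : LetterGrp d) (l : List (LetterGrp d)) :
    holG G Gb (a :: l) = realize G Gb a * holG G Gb l := rfl

omit [Algebra 𝕜 R] in
/-- [folklore] The transporter along a concatenation is the product. -/
theorem holG_append (G Gb : Form1 d R) (l₁ l₂ : List (LetterGrp d)) :
    holG G Gb (l₁ ++ l₂) = holG G Gb l₁ * holG G Gb l₂ := by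
  simp [holG, List.map_append, List.prod_append]

/-- [folklore] Naturality of `holG`. -/
theorem map_holG (φ : R →ₐ[𝕜] R') (G Gb : Form1 d R) (l : List (LetterGrp d)) :
    φ (holG G Gb l) = holG (fun κ x => φ (G κ x)) (fun κ x => φ (Gb κ x)) l := by
  induction l with
  | nil => simp
  | cons a l ih => simp only [holG_cons, map_mul, ih, map_realize]

omit [Algebra 𝕜 R] in
/-- [folklore] Trivial transporters give the trivial holonomy along any list of oriented bonds. -/
theorem holG_one {P : (Fin d → ℤ) → Prop} {l : List (LetterGrp d)} (hl : LettersIn δ P l) :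
    holG (fun _ _ => (1 : R)) (fun _ _ => 1) l = 1 := by
  induction l with
  | nil => rfl
  | cons a l ih =>
    rw [holG_cons, ih (fun b hb => hl b (List.mem_cons_of_mem a hb)), mul_one]
    obtain ⟨κ, x, -, h | h⟩ := hl a List.mem_cons_self
    · rw [h, realize_delta]
    · rw [h, realize_neg_delta]

omit [Algebra 𝕜 R] in
/-- [folklore] Node 5's `rev` of a concatenation. -/
theorem rev_append' (l₁ l₂ : List (LetterGrp d)) : rev (l₁ ++ l₂) = rev l₂ ++ rev l₁ := by
  simp [rev, List.map_append, List.reverse_append]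

omit [Algebra 𝕜 R] in
/-- [folklore] Node 5's `rev` of a singleton. -/
@[simp] theorem rev_single (a : LetterGrp d) : rev [a] = [-a] := rfl

omit [Algebra 𝕜 R] in
/-- [folklore] Node 5's `rev` of the empty list. -/
@[simp] theorem rev_nil' : rev ([] : List (LetterGrp d)) = [] := rfl

/-! ### Gauge transformations and telescoping -/

variable (u ub : (Fin d → ℤ) → R)

/-- [folklore] The gauge-transformed FORWARD transporter `u(x) G_f u(x + e_κ)⁻¹`. -/
def gaugeF (G : Form1 d R) : Form1 d R := fun κ x => u x * G κ x * ub (x + unitVec κ)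

/-- [folklore] The gauge-transformed BACKWARD transporter `u(x + e_κ) Ḡ_f u(x)⁻¹`. -/
def gaugeB (Gb : Form1 d R) : Form1 d R := fun κ x => u (x + unitVec κ) * Gb κ x * ub x

/-- [folklore] TELESCOPING along a list of oriented bonds forming a path from `s` to `e`. -/
def Tel (G Gb : Form1 d R) (l : List (LetterGrp d)) (s e : Fin d → ℤ) : Prop :=
  holG (gaugeF u ub G) (gaugeB u ub Gb) l = u s * holG G Gb l * ub e

variable {u ub} {G Gb : Form1 d R}

omit [Algebra 𝕜 R] in
/-- [folklore] Composition of two telescoped gauge factors. -/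
theorem tel_mul (hl : ∀ x, ub x * u x = 1) (a b : R) (s m e : Fin d → ℤ) :
    u s * a * ub m * (u m * b * ub e) = u s * (a * b) * ub e := by
  calc u s * a * ub m * (u m * b * ub e) = u s * a * (ub m * u m) * b * ub e := by simp only [mul_assoc]
    _ = u s * (a * b) * ub e := by rw [hl m]; simp only [mul_one, mul_assoc]

omit [Algebra 𝕜 R] in
/-- [folklore] Telescoping along the empty list. -/
theorem Tel.nil (hr : ∀ x, u x * ub x = 1) (s : Fin d → ℤ) : Tel u ub G Gb [] s s := by
  simp [Tel, hr]

omit [Algebra 𝕜 R] in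
/-- [folklore] Telescoping is stable under concatenation. -/
theorem Tel.append (hl : ∀ x, ub x * u x = 1) {l₁ l₂ : List (LetterGrp d)} {s m e : Fin d → ℤ}
    (h₁ : Tel u ub G Gb l₁ s m) (h₂ : Tel u ub G Gb l₂ m e) : Tel u ub G Gb (l₁ ++ l₂) s e := by
  unfold Tel at *
  rw [holG_append, holG_append, h₁, h₂, tel_mul hl]

omit [Algebra 𝕜 R] in
/-- [folklore] Telescoping along one forward letter. -/
theorem Tel.pos (κ : Fin d) (x : Fin d → ℤ) : Tel u ub G Gb [δ κ x] x (x + unitVec κ) := by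
  simp [Tel, gaugeF, mul_assoc]

omit [Algebra 𝕜 R] in
/-- [folklore] Telescoping along one backward letter. -/
theorem Tel.neg (κ : Fin d) (x : Fin d → ℤ) : Tel u ub G Gb [-δ κ x] (x + unitVec κ) x := by
  simp [Tel, gaugeB, mul_assoc]

omit [Algebra 𝕜 R] in
/-- [folklore] Transport of a telescoping statement along equal endpoints. -/
theorem Tel.of_eq {l : List (LetterGrp d)} {s e s' e' : Fin d → ℤ} (h : Tel u ub G Gb l s e) (hs : s = s')
    (he : e = e') : Tel u ub G Gb l s' e' := by
  subst hs he; exact h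

section Paths

variable (hr : ∀ x, u x * ub x = 1) (hl : ∀ x, ub x * u x = 1)
include hr hl

omit [Algebra 𝕜 R] in
/-- [folklore] Telescoping of gauge factors along node 5's `segUp`. -/
theorem tel_segUp (z : Fin d → ℤ) (κ : Fin d) (n : ℕ) :
    Tel u ub G Gb (segUp δ z κ n) z (z + (n : ℤ) • unitVec κ) := by
  induction n with
  | zero => simpa using Tel.nil hr z
  | succ n ih =>
    rw [segUp_succ]
    refine (Tel.append hl ih (Tel.pos κ _)).of_eq rfl ?_
    push_cast; rw [add_smul, one_smul, add_assoc]

omit [Algebra 𝕜 R] in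
/-- [folklore] Telescoping along the reverse of `segUp`. -/
theorem tel_rev_segUp (z : Fin d → ℤ) (κ : Fin d) (n : ℕ) :
    Tel u ub G Gb (rev (segUp δ z κ n)) (z + (n : ℤ) • unitVec κ) z := by
  induction n with
  | zero => simpa using Tel.nil hr z
  | succ n ih =>
    rw [segUp_succ, rev_append', rev_single]
    refine (Tel.append hl (Tel.neg κ _) ih).of_eq ?_ rfl
    push_cast; rw [add_smul, one_smul, add_assoc]

omit [Algebra 𝕜 R] in
/-- [folklore] Telescoping along node 5's `segDown`. -/
theorem tel_segDown (z : Fin d → ℤ) (κ : Fin d) (n : ℕ) :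
    Tel u ub G Gb (segDown δ z κ n) z (z - (n : ℤ) • unitVec κ) := by
  induction n with
  | zero => simpa using Tel.nil hr z
  | succ n ih =>
    have he : z - (((n : ℕ) : ℤ) + 1) • unitVec κ + unitVec κ = z - ((n : ℕ) : ℤ) • unitVec κ := by
      rw [add_smul, one_smul]; abel
    rw [segDown_succ]
    refine (Tel.append hl ih ((Tel.neg κ (z - (((n : ℕ) : ℤ) + 1) • unitVec κ)).of_eq he rfl)).of_eq rfl ?_
    push_cast; rfl

omit [Algebra 𝕜 R] in
/-- [folklore] Telescoping along the reverse of `segDown`. -/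
theorem tel_rev_segDown (z : Fin d → ℤ) (κ : Fin d) (n : ℕ) :
    Tel u ub G Gb (rev (segDown δ z κ n)) (z - (n : ℤ) • unitVec κ) z := by
  induction n with
  | zero => simpa using Tel.nil hr z
  | succ n ih =>
    have he : z - (((n : ℕ) : ℤ) + 1) • unitVec κ + unitVec κ = z - ((n : ℕ) : ℤ) • unitVec κ := by
      rw [add_smul, one_smul]; abel
    rw [segDown_succ, rev_append', rev_single, neg_neg]
    refine (Tel.append hl ((Tel.pos κ (z - (((n : ℕ) : ℤ) + 1) • unitVec κ)).of_eq rfl he) ih).of_eq ?_ rfl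
    push_cast; rfl

omit [Algebra 𝕜 R] in
/-- [folklore] Telescoping along node 5's `seg`. -/
theorem tel_seg (z : Fin d → ℤ) (κ : Fin d) (n : ℤ) : Tel u ub G Gb (seg δ z κ n) z (z + n • unitVec κ) := by
  unfold seg
  split_ifs with h
  · have := tel_segUp (G := G) (Gb := Gb) hr hl z κ n.toNat
    rwa [Int.toNat_of_nonneg h] at this
  · have := tel_segDown (G := G) (Gb := Gb) hr hl z κ (-n).toNat
    have hn : ((-n).toNat : ℤ) = -n := Int.toNat_of_nonneg (by omega)
    rwa [hn, neg_smul, sub_neg_eq_add] at this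

omit [Algebra 𝕜 R] in
/-- [folklore] Telescoping along the reverse of `seg`. -/
theorem tel_rev_seg (z : Fin d → ℤ) (κ : Fin d) (n : ℤ) :
    Tel u ub G Gb (rev (seg δ z κ n)) (z + n • unitVec κ) z := by
  unfold seg
  split_ifs with h
  · have := tel_rev_segUp (G := G) (Gb := Gb) hr hl z κ n.toNat
    rwa [Int.toNat_of_nonneg h] at this
  · have := tel_rev_segDown (G := G) (Gb := Gb) hr hl z κ (-n).toNat
    have hn : ((-n).toNat : ℤ) = -n := Int.toNat_of_nonneg (by omega)
    rwa [hn, neg_smul, sub_neg_eq_add] at this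

omit [Algebra 𝕜 R] in
/-- [folklore] Telescoping along node 5's `axialAux`. -/
theorem tel_axialAux (y x : Fin d → ℤ) :
    ∀ m, m ≤ d → Tel u ub G Gb (axialAux δ y x m) (corner y x m) x
      ∧ Tel u ub G Gb (rev (axialAux δ y x m)) x (corner y x m)
  | 0, _ => by simpa [axialAux] using Tel.nil hr x
  | m + 1, hm => by
    have h : m < d := by omega
    obtain ⟨ih, ih'⟩ := tel_axialAux y x m (by omega)
    simp only [axialAux, h, dif_pos]
    have hs := tel_seg (G := G) (Gb := Gb) hr hl (corner y x (m + 1)) ⟨m, h⟩ (x ⟨m, h⟩ - y ⟨m, h⟩)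
    have hs' := tel_rev_seg (G := G) (Gb := Gb) hr hl (corner y x (m + 1)) ⟨m, h⟩ (x ⟨m, h⟩ - y ⟨m, h⟩)
    rw [corner_succ_add] at hs hs'
    refine ⟨Tel.append hl hs ih, ?_⟩
    rw [rev_append']
    exact Tel.append hl ih' hs'

omit [Algebra 𝕜 R] in
/-- [folklore] Telescoping along node 5's `axial` path. -/
theorem tel_axial (y x : Fin d → ℤ) :
    Tel u ub G Gb (axial δ y x) y x ∧ Tel u ub G Gb (rev (axial δ y x)) x y := by
  have h := tel_axialAux (G := G) (Gb := Gb) hr hl y x d le_rfl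
  rwa [corner_d] at h

omit [Algebra 𝕜 R] in
/-- [folklore] TELESCOPING along `Γ_{c,x}`: from `c₋ = L·y` to `c₊ = L·y + L·e_μ`. -/
theorem tel_gammaC (L : ℕ) (μ : Fin d) (y : Fin d → ℤ) (b : Fin d → ℕ) :
    Tel u ub G Gb (gammaC δ L μ y b) ((L : ℤ) • y) ((L : ℤ) • y + (L : ℤ) • unitVec μ) := by
  unfold gammaC
  exact Tel.append hl (Tel.append hl (tel_axial hr hl _ _).1 (tel_segUp hr hl _ μ L))
    (tel_axial hr hl ((L : ℤ) • y + (L : ℤ) • unitVec μ) ((L : ℤ) • y + toSite b + (L : ℤ) • unitVec μ)).2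

omit [Algebra 𝕜 R] in
/-- [folklore] TELESCOPING along the straight coarse bond `c`. -/
theorem tel_cSeg (L : ℕ) (μ : Fin d) (y : Fin d → ℤ) :
    Tel u ub G Gb (segUp δ ((L : ℤ) • y) μ L) ((L : ℤ) • y) ((L : ℤ) • y + (L : ℤ) • unitVec μ) :=
  tel_segUp hr hl _ μ L

omit [Algebra 𝕜 R] in
/-- [folklore] TELESCOPING around the closed loop `Γ_{c,x} ∪ (−c)`: conjugation by `u(c₋)`. -/
theorem tel_loopC (L : ℕ) (μ : Fin d) (y : Fin d → ℤ) (b : Fin d → ℕ) :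
    Tel u ub G Gb (loopC δ L μ y b) ((L : ℤ) • y) ((L : ℤ) • y) := by
  unfold loopC
  exact Tel.append hl (tel_gammaC hr hl L μ y b) (tel_rev_segUp hr hl _ μ L)

end Paths

/-! ### Bałaban's one-step averaging (15)/(42) on group-valued transporters, its naturality and covariance -/

variable (𝕜)

/-- [folklore] THE ONE-STEP COVARIANT AVERAGING (15)/(42) in the truncated calculus, for a pair of transporter
assignments `(G, Ḡ)` (forward / backward): `Φ_b = expT( L^{−d} Σ_{x ∈ B(c₋)} logT hol(Γ_{c,x} ∪ (−c)) ) · hol(c)`. -/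
def PhiG (G Gb : Form1 d R) (L : ℕ) (μ : Fin d) (y : Fin d → ℤ) : R :=
  expT 𝕜 (((L : 𝕜) ^ d)⁻¹ • ∑ b ∈ box d L, logT 𝕜 (holG G Gb (loopC δ L μ y b)))
    * holG G Gb (segUp δ ((L : ℤ) • y) μ L)

variable {𝕜}

/-- [folklore] NATURALITY of the averaging under `𝕜`-algebra maps. -/
theorem map_PhiG (φ : R →ₐ[𝕜] R') (G Gb : Form1 d R) (L : ℕ) (μ : Fin d) (y : Fin d → ℤ) :
    φ (PhiG 𝕜 G Gb L μ y) = PhiG 𝕜 (fun κ x => φ (G κ x)) (fun κ x => φ (Gb κ x)) L μ y := by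
  simp only [PhiG, map_mul, map_expT, map_smul, map_sum, map_logT, map_holG]

/-- [folklore] The averaging of the trivial configuration is trivial. -/
theorem PhiG_one (L : ℕ) (μ : Fin d) (y : Fin d → ℤ) :
    PhiG 𝕜 (fun _ _ => (1 : R)) (fun _ _ => 1) L μ y = 1 := by
  have h1 : ∀ b ∈ box d L, logT 𝕜 (holG (fun _ _ => (1 : R)) (fun _ _ => 1) (loopC δ L μ y b)) = 0 := by
    intro b hb
    rw [holG_one (lettersIn_loopC δ L μ y hb), logT_one]
  rw [PhiG, Finset.sum_congr rfl h1, Finset.sum_const_zero, smul_zero, expT_zero, one_mul,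
    holG_one (lettersIn_cSeg δ L μ y)]

/-- [folklore] A scalar passes through a conjugation. -/
theorem smul_conj (c : 𝕜) (a S b : R) : c • (a * S * b) = a * (c • S) * b := by
  rw [← smul_mul_assoc, ← mul_smul_comm]

/-- [folklore] THE MOTHER IDENTITY (group-level gauge covariance of (15)/(42), B7 (11) «Ū^u = (Ū)^u» in the
truncated calculus): `Φ_b(G^u) = u(c₋) · Φ_b(G) · u(c₊)⁻¹`, EXACTLY, for any site function `u` with two-sided
inverse `ū`. No smallness, no commutativity, no nilpotency is used: only telescoping and the conjugation-equivariance
of the truncated series. -/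
theorem PhiG_gauge (hr : ∀ x, u x * ub x = 1) (hl : ∀ x, ub x * u x = 1) (G Gb : Form1 d R) (L : ℕ) (μ : Fin d)
    (y : Fin d → ℤ) :
    PhiG 𝕜 (gaugeF u ub G) (gaugeB u ub Gb) L μ y
      = u ((L : ℤ) • y) * PhiG 𝕜 G Gb L μ y * ub ((L : ℤ) • y + (L : ℤ) • unitVec μ) := by
  have hloop : ∀ b, holG (gaugeF u ub G) (gaugeB u ub Gb) (loopC δ L μ y b)
      = u ((L : ℤ) • y) * holG G Gb (loopC δ L μ y b) * ub ((L : ℤ) • y) :=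
    fun b => tel_loopC hr hl L μ y b
  have hc : holG (gaugeF u ub G) (gaugeB u ub Gb) (segUp δ ((L : ℤ) • y) μ L)
      = u ((L : ℤ) • y) * holG G Gb (segUp δ ((L : ℤ) • y) μ L) * ub ((L : ℤ) • y + (L : ℤ) • unitVec μ) :=
    tel_cSeg hr hl L μ y
  simp only [PhiG, hloop, hc, logT_conj (hr _) (hl _), ← Finset.sum_mul, ← Finset.mul_sum]
  rw [smul_conj, expT_conj (hr _) (hl _), tel_mul hl]

/- Sealed for the same reason as the truncated series (equation lemmas `holG_nil/cons/append`, `PhiG.eq_1`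
remain available). -/
attribute [irreducible] holG PhiG

end Letters

/-! ## §4 The product chart `U_f = X_f E_f` in `Rho 𝔸`, the averaged jet `Qjet` and its linearity -/

section Chart

variable (𝕜 : Type*) [Field 𝕜] {d : ℕ} {𝔸 : Type*} [Ring 𝔸] [Algebra 𝕜 𝔸]

open Tau

/-- [folklore] Lift of an `𝔸`-valued one-form to a `Tau 𝔸`-valued one (pure `c00` component). -/
def upF (W : Form1 d 𝔸) : Form1 d (Tau 𝔸) := fun κ x => ι (W κ x)

omit [Algebra 𝕜 𝔸] in
/-- [folklore] Evaluation of `upF`. -/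
@[simp] theorem upF_apply (W : Form1 d 𝔸) (κ : Fin d) (x : Fin d → ℤ) : upF W κ x = ι (W κ x) := rfl

/-- [folklore] THE TWO-PARAMETER BACKGROUND LETTER in the ORDERED chart:
`E_f = e^{τ₁ B_f} e^{τ₂ B′_f} = (1 + τ₁ B_f)(1 + τ₂ B′_f)` (exact: `τ₁² = τ₂² = 0`). -/
def Ebg (B B' : Form1 d 𝔸) : Form1 d (Tau 𝔸) := fun κ x => (1 + τ₁ * ι (B κ x)) * (1 + τ₂ * ι (B' κ x))

/-- [folklore] Its two-sided inverse `E_f⁻¹ = (1 − τ₂ B′_f)(1 − τ₁ B_f)`. -/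
def Ebi (B B' : Form1 d 𝔸) : Form1 d (Tau 𝔸) := fun κ x => (1 - τ₂ * ι (B' κ x)) * (1 - τ₁ * ι (B κ x))

section TauFacts

variable {𝕜}
variable (B B' : Form1 d 𝔸) (κ : Fin d) (x : Fin d → ℤ)

omit [Algebra 𝕜 𝔸] in
/-- [folklore] The `c00` component of the chart variable `Ebg`. -/
@[simp] theorem c00_Ebg : c00 (Ebg B B' κ x) = 1 := by simp [Ebg]
omit [Algebra 𝕜 𝔸] in
/-- [folklore] The `c10` component of the chart variable `Ebg`. -/
@[simp] theorem c10_Ebg : c10 (Ebg B B' κ x) = B κ x := by simp [Ebg]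
omit [Algebra 𝕜 𝔸] in
/-- [folklore] The `c01` component of the chart variable `Ebg`. -/
@[simp] theorem c01_Ebg : c01 (Ebg B B' κ x) = B' κ x := by simp [Ebg]
omit [Algebra 𝕜 𝔸] in
/-- [folklore] The `c11` component of the chart variable `Ebg`. -/
@[simp] theorem c11_Ebg : c11 (Ebg B B' κ x) = B κ x * B' κ x := by simp [Ebg]
omit [Algebra 𝕜 𝔸] in
/-- [folklore] The `c00` component of the inverse chart variable `Ebi`. -/
@[simp] theorem c00_Ebi : c00 (Ebi B B' κ x) = 1 := by simp [Ebi]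
omit [Algebra 𝕜 𝔸] in
/-- [folklore] The `c10` component of the inverse chart variable `Ebi`. -/
@[simp] theorem c10_Ebi : c10 (Ebi B B' κ x) = -B κ x := by simp [Ebi]
omit [Algebra 𝕜 𝔸] in
/-- [folklore] The `c01` component of the inverse chart variable `Ebi`. -/
@[simp] theorem c01_Ebi : c01 (Ebi B B' κ x) = -B' κ x := by simp [Ebi]
omit [Algebra 𝕜 𝔸] in
/-- [folklore] The `c11` component of the inverse chart variable `Ebi`. -/
@[simp] theorem c11_Ebi : c11 (Ebi B B' κ x) = B' κ x * B κ x := by simp [Ebi]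

omit [Algebra 𝕜 𝔸] in
/-- [folklore] `E_f⁻¹ E_f = 1`. -/
@[simp] theorem Ebi_mul_Ebg : Ebi B B' κ x * Ebg B B' κ x = 1 :=
  ext4 (by simp) (by simp) (by simp) (by simp)

omit [Algebra 𝕜 𝔸] in
/-- [folklore] `E_f E_f⁻¹ = 1`. -/
@[simp] theorem Ebg_mul_Ebi : Ebg B B' κ x * Ebi B B' κ x = 1 :=
  ext4 (by simp) (by simp) (by simp) (by simp; abel)

/-- [folklore] The ordered chart IS the product of two truncated exponentials (documentation of the chart). -/
theorem Ebg_eq_expT : Ebg B B' κ x = expT 𝕜 (τ₁ * ι (B κ x)) * expT 𝕜 (τ₂ * ι (B' κ x)) := by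
  have h1 : expT 𝕜 (τ₁ * ι (B κ x)) = 1 + τ₁ * ι (B κ x) := ext4 (by simp [expT]) (by simp [expT])
    (by simp [expT]) (by simp [expT])
  have h2 : expT 𝕜 (τ₂ * ι (B' κ x)) = 1 + τ₂ * ι (B' κ x) := ext4 (by simp [expT]) (by simp [expT])
    (by simp [expT]) (by simp [expT])
  rw [h1, h2, Ebg]

end TauFacts

/-- [folklore] THE PRODUCT CHART, fluctuation LEFT: the forward transporter `U_f = X_f E_f`, `X_f = 1 + ρ ω̂_f`
(`ω̂_f ∈ Tau 𝔸` the fluctuation letter), as an element `(E_f, ω̂_f E_f)` of `Rho 𝔸`. -/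
def Gf (ω : Form1 d (Tau 𝔸)) (B B' : Form1 d 𝔸) : Form1 d (Rho 𝔸) :=
  fun κ x => dmk 1 (ω κ x) * dmk (Ebg B B' κ x) 0

/-- [folklore] The backward transporter `U_f⁻¹ = E_f⁻¹ X_f⁻¹`, `X_f⁻¹ = 1 − ρ ω̂_f`. -/
def Gb (ω : Form1 d (Tau 𝔸)) (B B' : Form1 d 𝔸) : Form1 d (Rho 𝔸) :=
  fun κ x => dmk (Ebi B B' κ x) 0 * dmk 1 (-ω κ x)

section RhoFacts

variable {𝕜}
variable (ω : Form1 d (Tau 𝔸)) (B B' : Form1 d 𝔸) (κ : Fin d) (x : Fin d → ℤ)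

omit [Algebra 𝕜 𝔸] in
/-- [folklore] Background part of the forward chart variable. -/
@[simp] theorem fst_Gf : (Gf ω B B' κ x).fst = Ebg B B' κ x := by simp [Gf]
omit [Algebra 𝕜 𝔸] in
/-- [folklore] Fluctuation (`ρ`-) part of the forward chart variable. -/
@[simp] theorem snd_Gf : (Gf ω B B' κ x).snd = ω κ x * Ebg B B' κ x := by simp [Gf]
omit [Algebra 𝕜 𝔸] in
/-- [folklore] Background part of the backward chart variable. -/
@[simp] theorem fst_Gb : (Gb ω B B' κ x).fst = Ebi B B' κ x := by simp [Gb]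
omit [Algebra 𝕜 𝔸] in
/-- [folklore] Fluctuation (`ρ`-) part of the backward chart variable. -/
@[simp] theorem snd_Gb : (Gb ω B B' κ x).snd = -(Ebi B B' κ x * ω κ x) := by simp [Gb]

omit [Algebra 𝕜 𝔸] in
/-- [folklore] `U_f⁻¹ U_f = 1` in `Rho 𝔸` (exact). -/
theorem Gb_mul_Gf : Gb ω B B' κ x * Gf ω B B' κ x = 1 :=
  TrivSqZeroExt.ext (by simp) (by
    simp only [dsnd_mul, fst_Gb, snd_Gf, snd_Gb, fst_Gf, TrivSqZeroExt.snd_one, neg_mul, ← mul_assoc]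
    exact add_neg_cancel _)

omit [Algebra 𝕜 𝔸] in
/-- [folklore] `U_f U_f⁻¹ = 1` in `Rho 𝔸` (exact). -/
theorem Gf_mul_Gb : Gf ω B B' κ x * Gb ω B B' κ x = 1 :=
  TrivSqZeroExt.ext (by simp) (by
    simp only [dsnd_mul, fst_Gb, snd_Gf, snd_Gb, fst_Gf, TrivSqZeroExt.snd_one, mul_neg]
    rw [mul_assoc (ω κ x), Ebg_mul_Ebi, ← mul_assoc, Ebg_mul_Ebi]; simp)

/-- [folklore] NILPOTENCY in `Rho 𝔸`: the fourth power of an element of the augmentation ideal vanishes. -/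
theorem Rho.nil4 (n : Rho 𝔸) (h : c00 n.fst = 0) : n * n * n * n = 0 :=
  TrivSqZeroExt.ext (by simp only [dfst_mul, TrivSqZeroExt.fst_zero]; exact mul4_eq_zero_l _ h h h) (by
    simp only [dsnd_mul, dfst_mul, add_mul, TrivSqZeroExt.snd_zero, mul3_eq_zero h h h, zero_mul,
      mul4_eq_zero_l _ h h h, mul4_eq_zero_m _ h h h, mul4_eq_zero_r _ h h h, add_zero])

end RhoFacts

/-- [folklore] THE AVERAGED TWO-PARAMETER BACKGROUND FAMILY with fluctuation `ω̂`: (42) evaluated on the product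
chart, an element of `Rho 𝔸`. -/
def PhiR (ω : Form1 d (Tau 𝔸)) (B B' : Form1 d 𝔸) (L : ℕ) (μ : Fin d) (y : Fin d → ℤ) : Rho 𝔸 :=
  PhiG 𝕜 (Gf ω B B') (Gb ω B B') L μ y

/-- [folklore] The augmentation `Rho 𝔸 → 𝔸` (kill `ρ, τ₁, τ₂`). -/
def augR : Rho 𝔸 →ₐ[𝕜] 𝔸 := (Tau.aug (𝕜 := 𝕜)).comp (TrivSqZeroExt.fstHom 𝕜 (Tau 𝔸) (Tau 𝔸))

variable {𝕜}

/-- [folklore] Evaluation of `augR`. -/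
@[simp] theorem augR_apply (r : Rho 𝔸) : augR 𝕜 r = c00 r.fst := rfl

/-- [folklore] The averaged family is `1` modulo the augmentation ideal. -/
theorem augR_PhiR (ω : Form1 d (Tau 𝔸)) (B B' : Form1 d 𝔸) (L : ℕ) (μ : Fin d) (y : Fin d → ℤ) :
    augR 𝕜 (PhiR 𝕜 ω B B' L μ y) = 1 := by
  rw [PhiR, map_PhiG]
  simp only [augR_apply, fst_Gf, fst_Gb, c00_Ebg, c00_Ebi]
  exact PhiG_one L μ y

/-- [folklore] EXACT INVERTIBILITY: `Φ · invT Φ = 1` for the averaged family (its deviation from `1` has vanishing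
fourth power). -/
theorem PhiR_mul_invT (ω : Form1 d (Tau 𝔸)) (B B' : Form1 d 𝔸) (L : ℕ) (μ : Fin d) (y : Fin d → ℤ) :
    PhiR 𝕜 ω B B' L μ y * invT (PhiR 𝕜 ω B B' L μ y) = 1 := by
  have h := augR_PhiR (𝕜 := 𝕜) ω B B' L μ y
  rw [augR_apply] at h
  rw [mul_invT, Rho.nil4 _ (by simp [h]), sub_zero]

/-- [folklore] `invT Φ · Φ = 1` on the chart. -/
theorem invT_mul_PhiR (ω : Form1 d (Tau 𝔸)) (B B' : Form1 d 𝔸) (L : ℕ) (μ : Fin d) (y : Fin d → ℤ) :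
    invT (PhiR 𝕜 ω B B' L μ y) * PhiR 𝕜 ω B B' L μ y = 1 := by
  have h := augR_PhiR (𝕜 := 𝕜) ω B B' L μ y
  rw [augR_apply] at h
  rw [invT_mul, Rho.nil4 _ (by simp [h]), sub_zero]

variable (𝕜)

/-- [folklore] THE AVERAGED JET: the `ρ`-component of `logT( Φ(ω̂) · Φ(0)⁻¹ )` (right-trivialised by the pure
background averaging, as node 7b's THEOREM B), an element of `Tau 𝔸` whose four components are the jets of orders
`(σ, 1)`, `(σ, τ₁)`, `(σ, τ₂)`, `(σ, τ₁τ₂)`. -/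
def Qjet (ω : Form1 d (Tau 𝔸)) (B B' : Form1 d 𝔸) (L : ℕ) (μ : Fin d) (y : Fin d → ℤ) : Tau 𝔸 :=
  (logT 𝕜 (PhiR 𝕜 ω B B' L μ y * invT (PhiR 𝕜 0 B B' L μ y))).snd

variable {𝕜}

/-- [folklore] HOMOGENEITY of the averaged jet under CENTRAL scalars of `Tau 𝔸` (from naturality along
`scaleDual`). -/
theorem Qjet_mul_central (s : Tau 𝔸) (hs : ∀ t, s * t = t * s) (ω : Form1 d (Tau 𝔸)) (B B' : Form1 d 𝔸) (L : ℕ)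
    (μ : Fin d) (y : Fin d → ℤ) :
    Qjet 𝕜 (fun κ x => s * ω κ x) B B' L μ y = s * Qjet 𝕜 ω B B' L μ y := by
  have hG1 : ∀ κ x, scaleDual (𝕜 := 𝕜) s hs (Gf ω B B' κ x) = Gf (fun κ x => s * ω κ x) B B' κ x :=
    fun κ x => TrivSqZeroExt.ext (by simp) (by simp [mul_assoc])
  have hG0 : ∀ κ x, scaleDual (𝕜 := 𝕜) s hs (Gf 0 B B' κ x) = Gf 0 B B' κ x :=
    fun κ x => TrivSqZeroExt.ext (by simp) (by simp)
  have hGb1 : ∀ κ x, scaleDual (𝕜 := 𝕜) s hs (Gb ω B B' κ x) = Gb (fun κ x => s * ω κ x) B B' κ x :=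
    fun κ x => TrivSqZeroExt.ext (by simp)
      (by rw [snd_scaleDual, snd_Gb, snd_Gb, mul_neg, ← mul_assoc, hs, mul_assoc])
  have hGb0 : ∀ κ x, scaleDual (𝕜 := 𝕜) s hs (Gb 0 B B' κ x) = Gb 0 B B' κ x :=
    fun κ x => TrivSqZeroExt.ext (by simp) (by simp)
  unfold Qjet PhiR
  have key := congrArg TrivSqZeroExt.snd (map_logT (scaleDual (𝕜 := 𝕜) s hs)
    (PhiG 𝕜 (Gf ω B B') (Gb ω B B') L μ y * invT (PhiG 𝕜 (Gf 0 B B') (Gb 0 B B') L μ y)))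
  simp only [map_mul, map_invT, map_PhiG, hG1, hG0, hGb1, hGb0, snd_scaleDual] at key
  exact key.symm

/-- [folklore] The doubled forward configuration in `Rho 𝔸 [ρ′]`: `U_f = (1 + ρ ω̂₁ + ρ′ ω̂₂) E_f`. -/
def Gf2 (η₁ η₂ : Form1 d (Tau 𝔸)) (B B' : Form1 d 𝔸) : Form1 d (DualNumber (Rho 𝔸)) :=
  fun κ x => dmk (Gf η₁ B B' κ x) (dmk (η₂ κ x * Ebg B B' κ x) 0)

/-- [folklore] The doubled backward configuration `E_f⁻¹ (1 − ρ ω̂₁ − ρ′ ω̂₂)`. -/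
def Gb2 (η₁ η₂ : Form1 d (Tau 𝔸)) (B B' : Form1 d 𝔸) : Form1 d (DualNumber (Rho 𝔸)) :=
  fun κ x => dmk (Gb η₁ B B' κ x) (dmk (-(Ebi B B' κ x * η₂ κ x)) 0)

omit [Algebra 𝕜 𝔸] in
/-- [folklore] Background part of the two-fluctuation forward variable. -/
@[simp] theorem fst_Gf2 (η₁ η₂ : Form1 d (Tau 𝔸)) (B B' : Form1 d 𝔸) (κ : Fin d) (x : Fin d → ℤ) :
    (Gf2 η₁ η₂ B B' κ x).fst = Gf η₁ B B' κ x := rfl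
omit [Algebra 𝕜 𝔸] in
/-- [folklore] Fluctuation part of the two-fluctuation forward variable. -/
@[simp] theorem snd_Gf2 (η₁ η₂ : Form1 d (Tau 𝔸)) (B B' : Form1 d 𝔸) (κ : Fin d) (x : Fin d → ℤ) :
    (Gf2 η₁ η₂ B B' κ x).snd = dmk (η₂ κ x * Ebg B B' κ x) 0 := rfl
omit [Algebra 𝕜 𝔸] in
/-- [folklore] Background part of the two-fluctuation backward variable. -/
@[simp] theorem fst_Gb2 (η₁ η₂ : Form1 d (Tau 𝔸)) (B B' : Form1 d 𝔸) (κ : Fin d) (x : Fin d → ℤ) :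
    (Gb2 η₁ η₂ B B' κ x).fst = Gb η₁ B B' κ x := rfl
omit [Algebra 𝕜 𝔸] in
/-- [folklore] Fluctuation part of the two-fluctuation backward variable. -/
@[simp] theorem snd_Gb2 (η₁ η₂ : Form1 d (Tau 𝔸)) (B B' : Form1 d 𝔸) (κ : Fin d) (x : Fin d → ℤ) :
    (Gb2 η₁ η₂ B B' κ x).snd = dmk (-(Ebi B B' κ x * η₂ κ x)) 0 := rfl

set_option synthInstance.maxHeartbeats 200000 in
set_option maxHeartbeats 1600000 in
/-- [folklore] ADDITIVITY of the averaged jet in the fluctuation (from naturality along the three maps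
`Rho[ρ′] → Rho` killing `ρ′`, killing `ρ`, identifying `ρ′ = ρ`). -/
theorem Qjet_add (ω₁ ω₂ : Form1 d (Tau 𝔸)) (B B' : Form1 d 𝔸) (L : ℕ) (μ : Fin d) (y : Fin d → ℤ) :
    Qjet 𝕜 (ω₁ + ω₂) B B' L μ y = Qjet 𝕜 ω₁ B B' L μ y + Qjet 𝕜 ω₂ B B' L μ y := by
  have h2 : ∀ κ x, mapDual (TrivSqZeroExt.fstHom 𝕜 (Tau 𝔸) (Tau 𝔸)) (Gf2 ω₁ ω₂ B B' κ x) = Gf ω₂ B B' κ x :=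
    fun κ x => TrivSqZeroExt.ext (by simp) (by simp)
  have h2z : ∀ κ x, mapDual (TrivSqZeroExt.fstHom 𝕜 (Tau 𝔸) (Tau 𝔸)) (Gf2 0 0 B B' κ x) = Gf 0 B B' κ x :=
    fun κ x => TrivSqZeroExt.ext (by simp) (by simp)
  have h2b : ∀ κ x, mapDual (TrivSqZeroExt.fstHom 𝕜 (Tau 𝔸) (Tau 𝔸)) (Gb2 ω₁ ω₂ B B' κ x) = Gb ω₂ B B' κ x :=
    fun κ x => TrivSqZeroExt.ext (by simp) (by simp)
  have h2bz : ∀ κ x, mapDual (TrivSqZeroExt.fstHom 𝕜 (Tau 𝔸) (Tau 𝔸)) (Gb2 0 0 B B' κ x) = Gb 0 B B' κ x :=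
    fun κ x => TrivSqZeroExt.ext (by simp) (by simp)
  have h3 : ∀ κ x, mergeDual (𝕜 := 𝕜) (Gf2 ω₁ ω₂ B B' κ x) = Gf (ω₁ + ω₂) B B' κ x :=
    fun κ x => TrivSqZeroExt.ext (by simp) (by simp [add_mul])
  have h3z : ∀ κ x, mergeDual (𝕜 := 𝕜) (Gf2 0 0 B B' κ x) = Gf 0 B B' κ x :=
    fun κ x => TrivSqZeroExt.ext (by simp) (by simp)
  have h3b : ∀ κ x, mergeDual (𝕜 := 𝕜) (Gb2 ω₁ ω₂ B B' κ x) = Gb (ω₁ + ω₂) B B' κ x :=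
    fun κ x => TrivSqZeroExt.ext (by simp) (by
      rw [snd_mergeDual, fst_Gb2, snd_Gb2, snd_Gb, fst_dmk, snd_Gb, Pi.add_apply, Pi.add_apply, mul_add,
        neg_add])
  have h3bz : ∀ κ x, mergeDual (𝕜 := 𝕜) (Gb2 0 0 B B' κ x) = Gb 0 B B' κ x :=
    fun κ x => TrivSqZeroExt.ext (by simp) (by simp)
  unfold Qjet PhiR
  have k1 := congrArg TrivSqZeroExt.snd (map_logT (TrivSqZeroExt.fstHom 𝕜 (Rho 𝔸) (Rho 𝔸))
    (PhiG 𝕜 (Gf2 ω₁ ω₂ B B') (Gb2 ω₁ ω₂ B B') L μ y * invT (PhiG 𝕜 (Gf2 0 0 B B') (Gb2 0 0 B B') L μ y)))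
  simp only [map_mul, map_invT, map_PhiG, TrivSqZeroExt.fstHom_apply, fst_Gf2, fst_Gb2] at k1
  have k2 := congrArg TrivSqZeroExt.snd (map_logT (mapDual (TrivSqZeroExt.fstHom 𝕜 (Tau 𝔸) (Tau 𝔸)))
    (PhiG 𝕜 (Gf2 ω₁ ω₂ B B') (Gb2 ω₁ ω₂ B B') L μ y * invT (PhiG 𝕜 (Gf2 0 0 B B') (Gb2 0 0 B B') L μ y)))
  simp only [map_mul, map_invT, map_PhiG, h2, h2z, h2b, h2bz, snd_mapDual, TrivSqZeroExt.fstHom_apply] at k2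
  have k3 := congrArg TrivSqZeroExt.snd (map_logT (mergeDual (𝕜 := 𝕜))
    (PhiG 𝕜 (Gf2 ω₁ ω₂ B B') (Gb2 ω₁ ω₂ B B') L μ y * invT (PhiG 𝕜 (Gf2 0 0 B B') (Gb2 0 0 B B') L μ y)))
  simp only [map_mul, map_invT, map_PhiG, h3, h3z, h3b, h3bz, snd_mergeDual] at k3
  exact k3.symm.trans (congrArg₂ HAdd.hAdd k1 k2)

/-- [folklore] The averaged jet of the zero fluctuation vanishes. -/
@[simp] theorem Qjet_zero (B B' : Form1 d 𝔸) (L : ℕ) (μ : Fin d) (y : Fin d → ℤ) :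
    Qjet 𝕜 (0 : Form1 d (Tau 𝔸)) B B' L μ y = 0 := by
  have h := Qjet_add (𝕜 := 𝕜) (0 : Form1 d (Tau 𝔸)) 0 B B' L μ y
  rw [add_zero] at h
  exact left_eq_add.mp h

/-- [folklore] The averaged jet is odd in the fluctuation. -/
theorem Qjet_neg (ω : Form1 d (Tau 𝔸)) (B B' : Form1 d 𝔸) (L : ℕ) (μ : Fin d) (y : Fin d → ℤ) :
    Qjet 𝕜 (-ω) B B' L μ y = -Qjet 𝕜 ω B B' L μ y := by
  have h := Qjet_add (𝕜 := 𝕜) (-ω) ω B B' L μ y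
  rw [neg_add_cancel, Qjet_zero] at h
  exact (neg_eq_of_add_eq_zero_left h.symm).symm

/-- [folklore] The averaged jet is subtractive in the fluctuation. -/
theorem Qjet_sub (ω₁ ω₂ : Form1 d (Tau 𝔸)) (B B' : Form1 d 𝔸) (L : ℕ) (μ : Fin d) (y : Fin d → ℤ) :
    Qjet 𝕜 (ω₁ - ω₂) B B' L μ y = Qjet 𝕜 ω₁ B B' L μ y - Qjet 𝕜 ω₂ B B' L μ y := by
  rw [sub_eq_add_neg, Qjet_add, Qjet_neg, ← sub_eq_add_neg]

/-- [folklore] `𝕜`-HOMOGENEITY of the averaged jet. -/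
theorem Qjet_smul (r : 𝕜) (ω : Form1 d (Tau 𝔸)) (B B' : Form1 d 𝔸) (L : ℕ) (μ : Fin d) (y : Fin d → ℤ) :
    Qjet 𝕜 (r • ω) B B' L μ y = r • Qjet 𝕜 ω B B' L μ y := by
  have h := Qjet_mul_central (𝕜 := 𝕜) (algebraMap 𝕜 (Tau 𝔸) r) (fun t => Algebra.commutes r t) ω B B' L μ y
  simp only [← Algebra.smul_def] at h
  exact h

/-! ## §5 The `(B,B′)`-polarised WARD IDENTITY of the averaged jet

An infinitesimal gauge transformation `1 + ρλ` acts on the averaged family by the exact mother identity `PhiG_gauge`;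
on the zero-fluctuation chart it IS the chart with fluctuation `wU λ = λ(b₋) − E_b λ(b₊) E_b⁻¹`, whose
`Tau`-components are `−∇λ`, `−[B,λ₊]`, `−[B′,λ₊]`, `−[B,[B′,λ₊]]` (`wU_apply`).  For `λ` vanishing at the two coarse
endpoints the whole jet of the gauge mode vanishes (`Qjet_wU`); its `τ₁τ₂`-component is the Ward identity `ward`. -/

/-- [folklore] The infinitesimal gauge function `1 + ρ λ(x)` in `Rho 𝔸`. -/
def uG (lam : (Fin d → ℤ) → 𝔸) : (Fin d → ℤ) → Rho 𝔸 := fun x => dmk 1 (ι (lam x))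

/-- [folklore] Its two-sided inverse `1 − ρ λ(x)`. -/
def ubG (lam : (Fin d → ℤ) → 𝔸) : (Fin d → ℤ) → Rho 𝔸 := fun x => dmk 1 (-ι (lam x))

omit [Algebra 𝕜 𝔸] in
/-- [folklore] `(1 + ρλ)(1 − ρλ) = 1`. -/
theorem uG_mul_ubG (lam : (Fin d → ℤ) → 𝔸) (x : Fin d → ℤ) : uG lam x * ubG lam x = 1 :=
  TrivSqZeroExt.ext (by simp [uG, ubG]) (by simp [uG, ubG])

omit [Algebra 𝕜 𝔸] in
/-- [folklore] `(1 − ρλ)(1 + ρλ) = 1`. -/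
theorem ubG_mul_uG (lam : (Fin d → ℤ) → 𝔸) (x : Fin d → ℤ) : ubG lam x * uG lam x = 1 :=
  TrivSqZeroExt.ext (by simp [uG, ubG]) (by simp [uG, ubG])

omit [Algebra 𝕜 𝔸] in
/-- [folklore] `ι 0 = 0`. -/
@[simp] theorem ι_zero : (ι (0 : 𝔸) : Tau 𝔸) = 0 := ext4 (by simp) (by simp) (by simp) (by simp)

/-- [folklore] THE GAUGE MODE IN THE CHART: `w_b(λ) = λ(b₋) − E_b λ(b₊) E_b⁻¹ ∈ Tau 𝔸`. -/
def wU (lam : (Fin d → ℤ) → 𝔸) (B B' : Form1 d 𝔸) : Form1 d (Tau 𝔸) :=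
  fun κ x => ι (lam x) - Ebg B B' κ x * ι (lam (x + unitVec κ)) * Ebi B B' κ x

omit [Algebra 𝕜 𝔸] in
/-- [folklore] The gauge-mode fluctuation recombined with the chart (forward): `wU λ · E = ιλ(b₋) · E − E · ιλ(b₊)`. -/
theorem wU_mul_Ebg (lam : (Fin d → ℤ) → 𝔸) (B B' : Form1 d 𝔸) (κ : Fin d) (x : Fin d → ℤ) :
    wU lam B B' κ x * Ebg B B' κ x = ι (lam x) * Ebg B B' κ x - Ebg B B' κ x * ι (lam (x + unitVec κ)) := by
  rw [wU, sub_mul, mul_assoc _ (Ebi B B' κ x), Ebi_mul_Ebg, mul_one]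

omit [Algebra 𝕜 𝔸] in
/-- [folklore] The companion identity for the backward chart variable: `E⁻¹ · wU λ = E⁻¹ · ιλ(b₋) − ιλ(b₊) · E⁻¹`. -/
theorem Ebi_mul_wU (lam : (Fin d → ℤ) → 𝔸) (B B' : Form1 d 𝔸) (κ : Fin d) (x : Fin d → ℤ) :
    Ebi B B' κ x * wU lam B B' κ x = Ebi B B' κ x * ι (lam x) - ι (lam (x + unitVec κ)) * Ebi B B' κ x := by
  simp only [wU, mul_sub, ← mul_assoc, Ebi_mul_Ebg, one_mul]

omit [Algebra 𝕜 𝔸] in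
/-- [folklore] Gauging the zero-fluctuation chart gives the chart with fluctuation `wU λ` (forward letters). -/
theorem gaugeF_Gf_zero (lam : (Fin d → ℤ) → 𝔸) (B B' : Form1 d 𝔸) :
    gaugeF (uG lam) (ubG lam) (Gf 0 B B') = Gf (wU lam B B') B B' := by
  funext κ x
  refine TrivSqZeroExt.ext ?_ ?_
  · simp [gaugeF, uG, ubG]
  · rw [snd_Gf, wU_mul_Ebg]
    simp [gaugeF, uG, ubG]; abel

omit [Algebra 𝕜 𝔸] in
/-- [folklore] … and backward letters. -/
theorem gaugeB_Gb_zero (lam : (Fin d → ℤ) → 𝔸) (B B' : Form1 d 𝔸) :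
    gaugeB (uG lam) (ubG lam) (Gb 0 B B') = Gb (wU lam B B') B B' := by
  funext κ x
  refine TrivSqZeroExt.ext ?_ ?_
  · simp [gaugeB, uG, ubG]
  · rw [snd_Gb, Ebi_mul_wU]
    simp [gaugeB, uG, ubG]; abel

/-- [folklore] THE MOTHER IDENTITY ON THE CHART (exact, every `λ`): the infinitesimal gauge transform of the averaged
zero-fluctuation family is the averaged family with fluctuation `wU λ`. -/
theorem PhiR_wU (lam : (Fin d → ℤ) → 𝔸) (B B' : Form1 d 𝔸) (L : ℕ) (μ : Fin d) (y : Fin d → ℤ) :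
    PhiR 𝕜 (wU lam B B') B B' L μ y
      = uG lam ((L : ℤ) • y) * PhiR 𝕜 0 B B' L μ y * ubG lam ((L : ℤ) • y + (L : ℤ) • unitVec μ) := by
  rw [PhiR, PhiR, ← gaugeF_Gf_zero, ← gaugeB_Gb_zero]
  exact PhiG_gauge (u := uG lam) (ub := ubG lam) (uG_mul_ubG lam) (ubG_mul_uG lam) (Gf 0 B B') (Gb 0 B B') L μ y

/-- [folklore] THE JET OF A GAUGE MODE VANISHES: for `λ` vanishing at the two coarse endpoints `L•y`, `L•y + L•e_μ`
(the space `𝔫_ev` of node 11), `Qjet (wU λ) = 0` in `Tau 𝔸` — all four components at once. -/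
theorem Qjet_wU (lam : (Fin d → ℤ) → 𝔸) (B B' : Form1 d 𝔸) (L : ℕ) (μ : Fin d) (y : Fin d → ℤ)
    (h0 : lam ((L : ℤ) • y) = 0) (h1 : lam ((L : ℤ) • y + (L : ℤ) • unitVec μ) = 0) :
    Qjet 𝕜 (wU lam B B') B B' L μ y = 0 := by
  have hu : uG lam ((L : ℤ) • y) = 1 :=
    TrivSqZeroExt.ext (by simp [uG]) (by simp only [uG, snd_dmk, h0, ι_zero, TrivSqZeroExt.snd_one])
  have hub : ubG lam ((L : ℤ) • y + (L : ℤ) • unitVec μ) = 1 :=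
    TrivSqZeroExt.ext (by simp [ubG])
      (by simp only [ubG, snd_dmk, h1, ι_zero, neg_zero, TrivSqZeroExt.snd_one])
  unfold Qjet
  rw [PhiR_wU, hu, hub, one_mul, mul_one, PhiR_mul_invT, logT_one, TrivSqZeroExt.snd_zero]

/-- [folklore] The ORDERED double gauge mode `b ↦ [B_b, [B′_b, λ(b₊)]]`; on the diagonal `B′ = B` it is node 10's
`gmode2two` (`gmode2o_self`). -/
def gmode2o (B B' : Form1 d 𝔸) (lam : (Fin d → ℤ) → 𝔸) : Form1 d 𝔸 :=
  fun κ x => comm (B κ x) (comm (B' κ x) (lam (x + unitVec κ)))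

omit [Algebra 𝕜 𝔸] in
/-- [folklore] On the diagonal `B′ = B` the polarised second gauge mode is node 10's `gmode2two`. -/
theorem gmode2o_self (B : Form1 d 𝔸) (lam : (Fin d → ℤ) → 𝔸) : gmode2o B B lam = gmode2two B lam := rfl

omit [Algebra 𝕜 𝔸] in
/-- [folklore] COMPONENTS OF THE GAUGE MODE: `w(λ) = −(∇λ + τ₁[B,λ₊] + τ₂[B′,λ₊] + τ₁τ₂[B,[B′,λ₊]])`. -/
theorem wU_apply (lam : (Fin d → ℤ) → 𝔸) (B B' : Form1 d 𝔸) (κ : Fin d) (x : Fin d → ℤ) :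
    wU lam B B' κ x = -(ι (grad lam κ x) + τ₁ * ι (gmode1 B lam κ x) + τ₂ * ι (gmode1 B' lam κ x)
      + τ12 * ι (gmode2o B B' lam κ x)) :=
  ext4 (by simp [wU, Ebg, Ebi, grad])
    (by simp [wU, Ebg, Ebi, gmode1, AveragingHessianKernels.comm]; noncomm_ring)
    (by simp [wU, Ebg, Ebi, gmode1, AveragingHessianKernels.comm]; noncomm_ring)
    (by simp [wU, Ebg, Ebi, gmode2o, AveragingHessianKernels.comm]; noncomm_ring)

/-- [folklore] THE `(B,B′)`-POLARISED WARD IDENTITY OF THE AVERAGED JET: for `λ ∈ 𝔫_ev`,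
`T₂(∇λ; B, B′) + T₁⁽²⁾([B,λ₊]; B′-slot) + T₁⁽¹⁾([B′,λ₊]; B-slot) + T₀([B,[B′,λ₊]]) = 0`,
i.e. the `τ₁τ₂`-component of `Qjet (wU λ) = 0` after expanding `wU` by linearity of the jet in the fluctuation. -/
theorem ward (lam : (Fin d → ℤ) → 𝔸) (B B' : Form1 d 𝔸) (L : ℕ) (μ : Fin d) (y : Fin d → ℤ)
    (h0 : lam ((L : ℤ) • y) = 0) (h1 : lam ((L : ℤ) • y + (L : ℤ) • unitVec μ) = 0) :
    c11 (Qjet 𝕜 (upF (grad lam)) B B' L μ y) + c01 (Qjet 𝕜 (upF (gmode1 B lam)) B B' L μ y)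
      + c10 (Qjet 𝕜 (upF (gmode1 B' lam)) B B' L μ y) + c00 (Qjet 𝕜 (upF (gmode2o B B' lam)) B B' L μ y)
      = 0 := by
  have hw : wU lam B B' = -(upF (grad lam) + (fun κ x => τ₁ * upF (gmode1 B lam) κ x)
      + (fun κ x => τ₂ * upF (gmode1 B' lam) κ x) + (fun κ x => τ12 * upF (gmode2o B B' lam) κ x)) := by
    funext κ x
    simp only [Pi.neg_apply, Pi.add_apply, upF_apply]
    exact wU_apply lam B B' κ x
  have key := Qjet_wU (𝕜 := 𝕜) lam B B' L μ y h0 h1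
  rw [hw, Qjet_neg, Qjet_add, Qjet_add, Qjet_add, Qjet_mul_central τ₁ τ₁_comm, Qjet_mul_central τ₂ τ₂_comm,
    Qjet_mul_central τ12 τ12_comm, neg_eq_zero] at key
  simpa using congrArg c11 key

/-- [folklore] All four components of the vanishing gauge-mode jet, as a `Tau 𝔸`-identity. -/
theorem ward_Tau (lam : (Fin d → ℤ) → 𝔸) (B B' : Form1 d 𝔸) (L : ℕ) (μ : Fin d) (y : Fin d → ℤ)
    (h0 : lam ((L : ℤ) • y) = 0) (h1 : lam ((L : ℤ) • y + (L : ℤ) • unitVec μ) = 0) :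
    Qjet 𝕜 (upF (grad lam)) B B' L μ y + τ₁ * Qjet 𝕜 (upF (gmode1 B lam)) B B' L μ y
      + τ₂ * Qjet 𝕜 (upF (gmode1 B' lam)) B B' L μ y + τ12 * Qjet 𝕜 (upF (gmode2o B B' lam)) B B' L μ y
      = 0 := by
  have hw : wU lam B B' = -(upF (grad lam) + (fun κ x => τ₁ * upF (gmode1 B lam) κ x)
      + (fun κ x => τ₂ * upF (gmode1 B' lam) κ x) + (fun κ x => τ12 * upF (gmode2o B B' lam) κ x)) := by
    funext κ x
    simp only [Pi.neg_apply, Pi.add_apply, upF_apply]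
    exact wU_apply lam B B' κ x
  have key := Qjet_wU (𝕜 := 𝕜) lam B B' L μ y h0 h1
  rwa [hw, Qjet_neg, Qjet_add, Qjet_add, Qjet_add, Qjet_mul_central τ₁ τ₁_comm, Qjet_mul_central τ₂ τ₂_comm,
    Qjet_mul_central τ12 τ12_comm, neg_eq_zero] at key

/-! ## §6 Identification of the order-`0` component: `c00 (Qjet W) = L^{-d} • linAvg W`

Under the augmentation `Tau 𝔸 → 𝔸` the chart collapses to `DualNumber 𝔸`: the forward letter becomes `1 + ρ W_f`,
holonomies become `1 + ρ·(letter sum)`, the truncated logarithm of a loop holonomy is its letter sum, (42) evaluates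
to `1 + ρ (c_W + L^{-d} Σ_b s_b)`, and the contour bookkeeping `Σ_b s_b = linAvg W − L^d • c_W` (node 7b's
`sum_box_sum_loopC`, re-proved here over a bare ring) finishes: the order-`0` component of the jet is the letter
functional `L^{-d} • linAvg` of nodes 5/7a. -/

/-- [folklore] The additive letter homomorphism `δ_f ↦ W_f` on the free letter group. -/
def letterHom (W : Form1 d 𝔸) : LetterGrp d →+ 𝔸 :=
  Finsupp.liftAddHom fun f : Fin d × (Fin d → ℤ) => zmultiplesHom 𝔸 (W f.1 f.2)

omit [Algebra 𝕜 𝔸] in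
/-- [folklore] `letterHom W` evaluates a forward letter to `W_f`. -/
@[simp] theorem letterHom_δ (W : Form1 d 𝔸) (κ : Fin d) (x : Fin d → ℤ) : letterHom W (δ κ x) = W κ x := by
  simp [letterHom, δ]

omit [Algebra 𝕜 𝔸] in
/-- [folklore] Pushing the letter form `δ` along `letterHom W` gives back `W`. -/
theorem mapForm_letterHom (W : Form1 d 𝔸) : mapForm (letterHom W) δ = W := by
  funext κ x; simp

/-- [folklore] The order-`0` shadow of the chart: forward letter `1 + ρ W_f ∈ DualNumber 𝔸`. -/
def X1 (W : Form1 d 𝔸) : Form1 d (DualNumber 𝔸) := fun κ x => dmk 1 (W κ x)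

/-- [folklore] … and backward letter `1 − ρ W_f`. -/
def X1b (W : Form1 d 𝔸) : Form1 d (DualNumber 𝔸) := fun κ x => dmk 1 (-W κ x)

omit [Algebra 𝕜 𝔸] in
/-- [folklore] `(1 + σa)(1 + σb) = 1 + σ(a + b)` in `DualNumber 𝔸`. -/
theorem dmk_one_mul_dmk_one (a b : 𝔸) : (dmk 1 a : DualNumber 𝔸) * dmk 1 b = dmk 1 (a + b) :=
  TrivSqZeroExt.ext (by simp) (by simp [add_comm])

omit [Algebra 𝕜 𝔸] in
/-- [folklore] First-order holonomy = `1 + ρ·(letter sum)`. -/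
theorem holG_X1 (W : Form1 d 𝔸) {P : (Fin d → ℤ) → Prop} {l : List (LetterGrp d)} (hl : LettersIn δ P l) :
    holG (X1 W) (X1b W) l = dmk 1 ((l.map (letterHom W)).sum) := by
  induction l with
  | nil => simp only [holG_nil, List.map_nil, List.sum_nil]; rfl
  | cons a l ih =>
    have ha := hl a (by simp)
    have hl' : LettersIn δ P l := fun b hb => hl b (by simp [hb])
    obtain ⟨κ, x, -, rfl | rfl⟩ := ha
    · rw [holG_cons, ih hl', realize_delta, List.map_cons, List.sum_cons, letterHom_δ]
      exact dmk_one_mul_dmk_one _ _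
    · rw [holG_cons, ih hl', realize_neg_delta, List.map_cons, List.sum_cons, map_neg, letterHom_δ]
      exact dmk_one_mul_dmk_one _ _

/-- [folklore] `logT (1 + σs) = σs`. -/
theorem logT_dmk_one (s : 𝔸) : logT 𝕜 (dmk (1 : 𝔸) s) = dmk 0 s := by
  have h1 : (dmk (1 : 𝔸) s) - 1 = dmk 0 s := TrivSqZeroExt.ext (by simp) (by simp)
  have h2 : (dmk (0 : 𝔸) s) * dmk 0 s = 0 := TrivSqZeroExt.ext (by simp) (by simp)
  rw [logT, h1, h2, zero_mul, smul_zero, smul_zero, sub_zero, add_zero]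

/-- [folklore] `expT (σS) = 1 + σS`. -/
theorem expT_dmk_zero (S : 𝔸) : expT 𝕜 (dmk (0 : 𝔸) S) = dmk 1 S := by
  have h2 : (dmk (0 : 𝔸) S) * dmk 0 S = 0 := TrivSqZeroExt.ext (by simp) (by simp)
  rw [expT, h2, zero_mul, smul_zero, smul_zero, add_zero, add_zero]
  exact TrivSqZeroExt.ext (by simp) (by simp)

omit [Algebra 𝕜 𝔸] in
/-- [folklore] A finite sum of pure-`σ` dual numbers. -/
theorem sum_dmk_zero {ι' : Type*} (s : Finset ι') (f : ι' → 𝔸) :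
    ∑ i ∈ s, (dmk (0 : 𝔸) (f i)) = dmk 0 (∑ i ∈ s, f i) :=
  TrivSqZeroExt.ext (by simp [TrivSqZeroExt.fst_sum]) (by simp [TrivSqZeroExt.snd_sum])

/-- [folklore] A scalar multiple of a pure-`σ` dual number. -/
theorem smul_dmk_zero (c : 𝕜) (S : 𝔸) : c • (dmk (0 : 𝔸) S) = dmk 0 (c • S) :=
  TrivSqZeroExt.ext (by simp) (by simp)

omit [Algebra 𝕜 𝔸] in
/-- [folklore] CONTOUR BOOKKEEPING over an arbitrary additive group (node 7b's `sum_box_sum_loopC` carries a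
`NormedRing` section variable and is not applicable to the formal parameter rings; this is its additive form for any
`AddCommGroup`): `Σ_{x ∈ B(c₋)} A(loop_x) + L^d • A(c) = linAvg A`. -/
theorem sum_box_sum_loopC_add {R : Type*} [AddCommGroup R] (A : Form1 d R) (L : ℕ) (μ : Fin d) (y : Fin d → ℤ) :
    ∑ b ∈ box d L, (loopC A L μ y b).sum + (L ^ d) • (segUp A ((L : ℤ) • y) μ L).sum = linAvg A L μ y := by
  have hcard : (box d L).card = L ^ d := by simp [AffineAveraging.box, Fintype.card_piFinset]
  have hloop : ∀ b, (loopC A L μ y b).sum = (gammaC A L μ y b).sum - (segUp A ((L : ℤ) • y) μ L).sum := by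
    intro b; simp only [loopC, List.sum_append, rev_sum]; abel
  simp only [hloop, Finset.sum_sub_distrib, Finset.sum_const, hcard, linAvg, sub_add_cancel]

/-- [folklore] (42) on the order-`0` shadow: `Φ(1 + ρV) = 1 + ρ (c_V + L^{-d} Σ_b s_b(V))`. -/
theorem PhiG_X1 (V : Form1 d 𝔸) (L : ℕ) (μ : Fin d) (y : Fin d → ℤ) :
    PhiG 𝕜 (X1 V) (X1b V) L μ y
      = dmk 1 ((segUp V ((L : ℤ) • y) μ L).sum + ((L : 𝕜) ^ d)⁻¹ • ∑ b ∈ box d L, (loopC V L μ y b).sum) := by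
  rw [PhiG]
  have hlog : ∀ b ∈ box d L,
      logT 𝕜 (holG (X1 V) (X1b V) (loopC δ L μ y b)) = dmk 0 ((loopC V L μ y b).sum) := by
    intro b hb
    rw [holG_X1 V (lettersIn_loopC δ L μ y hb), loopC_map, mapForm_letterHom]
    exact logT_dmk_one _
  rw [Finset.sum_congr rfl hlog, holG_X1 V (lettersIn_cSeg δ L μ y), segUp_map, mapForm_letterHom,
    sum_dmk_zero, smul_dmk_zero, expT_dmk_zero]
  exact TrivSqZeroExt.ext (by simp) (by simp)

/-- [folklore] ORDER-`0` IDENTIFICATION: the `c00`-component of the averaged jet of `W` is the letter functional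
`L^{-d} • linAvg W` (nodes 5/7a), for every background pair `(B, B′)`. -/
theorem c00_Qjet (W B B' : Form1 d 𝔸) {L : ℕ} (hL : (L : 𝕜) ≠ 0) (μ : Fin d) (y : Fin d → ℤ) :
    c00 (Qjet 𝕜 (upF W) B B' L μ y) = ((L : 𝕜) ^ d)⁻¹ • linAvg W L μ y := by
  have hG : ∀ κ x, mapDual (Tau.aug (𝕜 := 𝕜)) (Gf (upF W) B B' κ x) = X1 W κ x :=
    fun κ x => TrivSqZeroExt.ext (by simp [X1]) (by simp [X1])
  have hGb : ∀ κ x, mapDual (Tau.aug (𝕜 := 𝕜)) (Gb (upF W) B B' κ x) = X1b W κ x :=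
    fun κ x => TrivSqZeroExt.ext (by simp [X1b]) (by simp [X1b])
  have hG0 : ∀ κ x, mapDual (Tau.aug (𝕜 := 𝕜)) (Gf 0 B B' κ x) = 1 :=
    fun κ x => TrivSqZeroExt.ext (by simp) (by simp)
  have hGb0 : ∀ κ x, mapDual (Tau.aug (𝕜 := 𝕜)) (Gb 0 B B' κ x) = 1 :=
    fun κ x => TrivSqZeroExt.ext (by simp) (by simp)
  unfold Qjet PhiR
  have key := congrArg TrivSqZeroExt.snd (map_logT (R := Rho 𝔸) (R' := DualNumber 𝔸)
    (mapDual (Tau.aug (𝕜 := 𝕜)))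
    (PhiG 𝕜 (Gf (upF W) B B') (Gb (upF W) B B') L μ y * invT (PhiG 𝕜 (Gf 0 B B') (Gb 0 B B') L μ y)))
  simp only [map_mul, map_invT, map_PhiG, hG, hGb, hG0, hGb0, snd_mapDual, Tau.aug_apply] at key
  rw [PhiG_one, invT_one, mul_one] at key
  refine key.trans ?_
  have hX : PhiG 𝕜 (fun κ x => X1 W κ x) (fun κ x => X1b W κ x) L μ y = PhiG 𝕜 (X1 W) (X1b W) L μ y := rfl
  rw [hX, PhiG_X1, logT_dmk_one, snd_dmk, eq_sub_of_add_eq (sum_box_sum_loopC_add W L μ y), smul_sub,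
    ← Nat.cast_smul_eq_nsmul 𝕜, Nat.cast_pow, smul_smul, inv_mul_cancel₀ (pow_ne_zero d hL), one_smul]
  abel


/-! ## §7 Identification of the order-`1` components: `c10 (Qjet W) = (2L^{2d})⁻¹ • vhU W B` and
`c01 (Qjet W) = (2L^{2d})⁻¹ • vhU W B′`

Killing one of the two background parameters collapses the chart onto the ring `Tau 𝔸` read as
`𝔸[σ,ρ]/(σ²,ρ²)` (`σ` = the surviving background parameter in the `τ₁`-slot, `ρ` = the fluctuation parameter in
the `τ₂`-slot; `piB`, `piB'`): the forward letter becomes `Y_f = (1 + ρ W_f)(1 + σ B_f)`.  The augmentation ideal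
of this ring has cube zero, so holonomies and their truncated logarithms are governed by SECOND-ORDER BCH: twice
the `σρ`-component of `log hol(ℓ)` is `Σ_ℓ [W,B] + cross_ℓ(W,B)` in node 7a's notation (`hol_cross`);
assembling (42) and comparing with node 7a's `vhU` gives the identification (`c10_Qjet`, `c01_Qjet`). -/

/-- [folklore] One-parameter shadow of the chart: forward letter `(1 + ρ W_f)(1 + σ B_f) ∈ Tau 𝔸`. -/
def Yf (W B : Form1 d 𝔸) : Form1 d (Tau 𝔸) := fun κ x => mk 1 (B κ x) (W κ x) (W κ x * B κ x)

/-- [folklore] … backward letter `(1 − σ B_f)(1 − ρ W_f)`. -/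
def Yb (W B : Form1 d 𝔸) : Form1 d (Tau 𝔸) := fun κ x => mk 1 (-B κ x) (-W κ x) (B κ x * W κ x)

/-- [folklore] The projection `Rho 𝔸 → Tau 𝔸` killing `τ₂` and moving `ρ` into the freed slot. -/
def piB : Rho 𝔸 →ₐ[𝕜] Tau 𝔸 where
  toFun r := mk (c00 r.fst) (c10 r.fst) (c00 r.snd) (c10 r.snd)
  map_one' := ext4 (by simp) (by simp) (by simp) (by simp)
  map_mul' r r' := ext4 (by simp) (by simp) (by simp) (by simp)
  map_zero' := ext4 (by simp) (by simp) (by simp) (by simp)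
  map_add' r r' := ext4 (by simp) (by simp) (by simp) (by simp)
  commutes' c := ext4 (by simp [Algebra.algebraMap_eq_smul_one])
    (by simp [Algebra.algebraMap_eq_smul_one])
    (by simp [Algebra.algebraMap_eq_smul_one])
    (by simp [Algebra.algebraMap_eq_smul_one])

/-- [folklore] The projection `Rho 𝔸 → Tau 𝔸` killing `τ₁` (and moving `τ₂` into the `τ₁`-slot, `ρ` into the
`τ₂`-slot). -/
def piB' : Rho 𝔸 →ₐ[𝕜] Tau 𝔸 where
  toFun r := mk (c00 r.fst) (c01 r.fst) (c00 r.snd) (c01 r.snd)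
  map_one' := ext4 (by simp) (by simp) (by simp) (by simp)
  map_mul' r r' := ext4 (by simp) (by simp) (by simp) (by simp)
  map_zero' := ext4 (by simp) (by simp) (by simp) (by simp)
  map_add' r r' := ext4 (by simp) (by simp) (by simp) (by simp)
  commutes' c := ext4 (by simp [Algebra.algebraMap_eq_smul_one])
    (by simp [Algebra.algebraMap_eq_smul_one])
    (by simp [Algebra.algebraMap_eq_smul_one])
    (by simp [Algebra.algebraMap_eq_smul_one])

/-- [folklore] Evaluation of `piB`. -/
@[simp] theorem piB_apply (r : Rho 𝔸) :
    piB (𝕜 := 𝕜) r = mk (c00 r.fst) (c10 r.fst) (c00 r.snd) (c10 r.snd) := rfl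

/-- [folklore] Evaluation of `piB′`. -/
@[simp] theorem piB'_apply (r : Rho 𝔸) :
    piB' (𝕜 := 𝕜) r = mk (c00 r.fst) (c01 r.fst) (c00 r.snd) (c01 r.snd) := rfl

omit [Algebra 𝕜 𝔸] in
/-- [folklore] Components `1, Σ_ℓ B, Σ_ℓ W` of a one-parameter holonomy. -/
theorem holY_c (W B : Form1 d 𝔸) {P : (Fin d → ℤ) → Prop} {l : List (LetterGrp d)} (hl : LettersIn δ P l) :
    c00 (holG (Yf W B) (Yb W B) l) = 1 ∧ c10 (holG (Yf W B) (Yb W B) l) = (l.map (letterHom B)).sum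
      ∧ c01 (holG (Yf W B) (Yb W B) l) = (l.map (letterHom W)).sum := by
  induction l with
  | nil => simp
  | cons a l ih =>
    obtain ⟨h0, h1, h2⟩ := ih (fun b hb => hl b (by simp [hb]))
    obtain ⟨κ, x, -, rfl | rfl⟩ := hl a (by simp)
    · rw [holG_cons, realize_delta]
      exact ⟨by simp [Yf, h0], by simp [Yf, h0, h1, add_comm], by simp [Yf, h0, h2, add_comm]⟩
    · rw [holG_cons, realize_neg_delta]
      exact ⟨by simp [Yb, h0], by simp [Yb, h0, h1, add_comm], by simp [Yb, h0, h2, add_comm]⟩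

omit [Algebra 𝕜 𝔸] in
/-- [folklore] The zero-fluctuation one-parameter holonomy `1 + σ Σ_ℓ B`. -/
theorem holY_zero (B : Form1 d 𝔸) {P : (Fin d → ℤ) → Prop} {l : List (LetterGrp d)} (hl : LettersIn δ P l) :
    holG (Yf 0 B) (Yb 0 B) l = mk 1 ((l.map (letterHom B)).sum) 0 0 := by
  induction l with
  | nil => simp only [holG_nil, List.map_nil, List.sum_nil]; exact ext4 rfl rfl rfl rfl
  | cons a l ih =>
    have hl' : LettersIn δ P l := fun b hb => hl b (by simp [hb])
    obtain ⟨κ, x, -, rfl | rfl⟩ := hl a (by simp)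
    · rw [holG_cons, ih hl', realize_delta]
      exact ext4 (by simp [Yf]) (by simp [Yf, add_comm]) (by simp [Yf]) (by simp [Yf])
    · rw [holG_cons, ih hl', realize_neg_delta]
      exact ext4 (by simp [Yb]) (by simp [Yb, add_comm]) (by simp [Yb]) (by simp [Yb])

/-- [folklore] The additive letter-pair homomorphism `δ_f ↦ (W_f, B_f)`. -/
def letterHom₂ (W B : Form1 d 𝔸) : LetterGrp d →+ 𝔸 × 𝔸 := (letterHom W).prod (letterHom B)

omit [Algebra 𝕜 𝔸] in
/-- [folklore] First component of `letterHom₂`. -/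
@[simp] theorem letterHom₂_fst (W B : Form1 d 𝔸) (a : LetterGrp d) : (letterHom₂ W B a).1 = letterHom W a := rfl

omit [Algebra 𝕜 𝔸] in
/-- [folklore] Second component of `letterHom₂`. -/
@[simp] theorem letterHom₂_snd (W B : Form1 d 𝔸) (a : LetterGrp d) : (letterHom₂ W B a).2 = letterHom B a := rfl

omit [Algebra 𝕜 𝔸] in
/-- [folklore] Pushing `δ` along `letterHom₂ W B` gives node 6's `pairForm W B`. -/
theorem mapForm_letterHom₂ (W B : Form1 d 𝔸) : mapForm (letterHom₂ W B) δ = pairForm W B := by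
  funext κ x; exact Prod.ext (by simp [pairForm]) (by simp [pairForm])

omit [Algebra 𝕜 𝔸] in
/-- [folklore] The `fl`-sum of a list mapped by `letterHom₂ W B` is its `letterHom B`-sum. -/
theorem fl_sum_letterHom₂ (W B : Form1 d 𝔸) (l : List (LetterGrp d)) :
    (fl (l.map (letterHom₂ W B))).sum = (l.map (letterHom B)).sum := by
  induction l with
  | nil => simp
  | cons a l ih => simp [ih]

omit [Algebra 𝕜 𝔸] in
/-- [folklore] The `bg`-sum of a list mapped by `letterHom₂ W B` is its `letterHom W`-sum. -/
theorem bg_sum_letterHom₂ (W B : Form1 d 𝔸) (l : List (LetterGrp d)) :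
    (bg (l.map (letterHom₂ W B))).sum = (l.map (letterHom W)).sum := by
  induction l with
  | nil => simp
  | cons a l ih => simp [ih]

omit [Algebra 𝕜 𝔸] in
/-- [folklore] SECOND-ORDER BCH ALONG A PATH: twice the `σρ`-component of the holonomy, minus the symmetrised
product of its first-order components, is node 7a's `Σ_ℓ [W,B] + cross_ℓ (W,B)`. -/
theorem hol_cross (W B : Form1 d 𝔸) {P : (Fin d → ℤ) → Prop} {l : List (LetterGrp d)} (hl : LettersIn δ P l) :
    c11 (holG (Yf W B) (Yb W B) l) + c11 (holG (Yf W B) (Yb W B) l)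
        - ((l.map (letterHom B)).sum * (l.map (letterHom W)).sum
            + (l.map (letterHom W)).sum * (l.map (letterHom B)).sum)
      = (l.map (letterHom (bw W B))).sum + cross (l.map (letterHom₂ W B)) := by
  induction l with
  | nil => simp
  | cons a l ih =>
    have hl' : LettersIn δ P l := fun b hb => hl b (by simp [hb])
    obtain ⟨h0, h1, h2⟩ := holY_c W B hl'
    specialize ih hl'
    obtain ⟨κ, x, -, rfl | rfl⟩ := hl a (by simp)
    · have hc : c11 (Yf W B κ x * holG (Yf W B) (Yb W B) l) = c11 (holG (Yf W B) (Yb W B) l)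
          + B κ x * (l.map (letterHom W)).sum + W κ x * (l.map (letterHom B)).sum + W κ x * B κ x := by
        rw [c11_mul, h0, h1, h2]; simp [Yf, add_assoc]
      rw [holG_cons, realize_delta, hc]
      simp only [List.map_cons, List.sum_cons, cross_cons, fl_sum_letterHom₂, bg_sum_letterHom₂, letterHom_δ,
        bw_apply]
      rw [← sub_eq_zero]
      refine Eq.trans ?_ (sub_eq_zero.mpr ih)
      simp only [letterHom₂_fst, letterHom₂_snd, letterHom_δ, AveragingHessianKernels.comm]
      noncomm_ring
    · have hc : c11 (Yb W B κ x * holG (Yf W B) (Yb W B) l) = c11 (holG (Yf W B) (Yb W B) l)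
          - B κ x * (l.map (letterHom W)).sum - W κ x * (l.map (letterHom B)).sum + B κ x * W κ x := by
        rw [c11_mul, h0, h1, h2]; simp [Yb]; abel
      rw [holG_cons, realize_neg_delta, hc]
      simp only [List.map_cons, List.sum_cons, cross_cons, fl_sum_letterHom₂, bg_sum_letterHom₂, map_neg,
        letterHom_δ, bw_apply]
      rw [← sub_eq_zero]
      refine Eq.trans ?_ (sub_eq_zero.mpr ih)
      simp only [Prod.fst_neg, Prod.snd_neg, letterHom₂_fst, letterHom₂_snd, letterHom_δ,
        AveragingHessianKernels.comm]
      noncomm_ring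

/-- [folklore] The truncated logarithm of a group-like element of `Tau 𝔸` (second-order BCH correction in the
`σρ`-slot). -/
theorem logT_of_c00 (q : Tau 𝔸) (h : c00 q = 1) :
    logT 𝕜 q = mk 0 (c10 q) (c01 q) (c11 q - (2 : 𝕜)⁻¹ • (c10 q * c01 q + c01 q * c10 q)) :=
  ext4 (by simp [logT, h]) (by simp [logT, h]) (by simp [logT, h]) (by simp [logT, h])

/-- [folklore] The truncated exponential of an element of the augmentation ideal of `Tau 𝔸`. -/
theorem expT_of_c00 (A : Tau 𝔸) (h : c00 A = 0) :
    expT 𝕜 A = mk 1 (c10 A) (c01 A) (c11 A + (2 : 𝕜)⁻¹ • (c10 A * c01 A + c01 A * c10 A)) :=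
  ext4 (by simp [expT, h]) (by simp [expT, h]) (by simp [expT, h]) (by simp [expT, h])

omit [Algebra 𝕜 𝔸] in
/-- [folklore] `invT (1 + σs) = 1 − σs` in `Tau 𝔸`. -/
theorem invT_mk_one (s : 𝔸) : invT (mk 1 s 0 0) = mk 1 (-s) 0 0 :=
  ext4 (by simp [invT]) (by simp [invT]) (by simp [invT]) (by simp [invT])

omit [Algebra 𝕜 𝔸] in
/-- [folklore] A finite sum of elements of `Tau 𝔸` with vanishing `c00`, componentwise. -/
theorem sum_mk_zero {ι' : Type*} (s : Finset ι') (f g h : ι' → 𝔸) :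
    ∑ i ∈ s, mk 0 (f i) (g i) (h i) = mk 0 (∑ i ∈ s, f i) (∑ i ∈ s, g i) (∑ i ∈ s, h i) :=
  ext4 (by simp) (by simp) (by simp) (by simp)

/-- [folklore] Scalar multiplication on `Tau 𝔸`, componentwise. -/
theorem smul_mk (c : 𝕜) (a b e f : 𝔸) : c • mk a b e f = mk (c • a) (c • b) (c • e) (c • f) :=
  ext4 (by simp) (by simp) (by simp) (by simp)

/-- [folklore] `H − ½s = ½r` from `2H − s = r` (`2` invertible in `𝕜`). -/
theorem half_of_two (h2 : (2 : 𝕜) ≠ 0) {H s r : 𝔸} (hx : H + H - s = r) :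
    H - (2 : 𝕜)⁻¹ • s = (2 : 𝕜)⁻¹ • r := by
  rw [← hx, smul_sub, ← two_smul 𝕜 H, smul_smul, inv_mul_cancel₀ h2, one_smul]

/-- [folklore] `H = ½(r + s)` from `2H − s = r` (`2` invertible in `𝕜`). -/
theorem eq_half (h2 : (2 : 𝕜) ≠ 0) {H s r : 𝔸} (hx : H + H - s = r) : H = (2 : 𝕜)⁻¹ • (r + s) := by
  rw [← hx, sub_add_cancel, ← two_smul 𝕜 H, smul_smul, inv_mul_cancel₀ h2, one_smul]

/-- [folklore] THE ONE-PARAMETER COMPUTATION: the `σρ`-component of the averaged jet on the shadow chart is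
`(2L^{2d})⁻¹ • vhU W B` (node 7a). -/
theorem c11_logT_PhiY (W B : Form1 d 𝔸) {L : ℕ} (hL : (L : 𝕜) ≠ 0) (h2 : (2 : 𝕜) ≠ 0) (μ : Fin d)
    (y : Fin d → ℤ) :
    c11 (logT 𝕜 (PhiG 𝕜 (Yf W B) (Yb W B) L μ y * invT (PhiG 𝕜 (Yf 0 B) (Yb 0 B) L μ y)))
      = ((2 : 𝕜) * (L : 𝕜) ^ (2 * d))⁻¹ • vhU W B L μ y := by
  have hℓ : ((L : 𝕜) ^ d) ≠ 0 := pow_ne_zero d hL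
  -- loop data
  have hb : ∀ b ∈ box d L, logT 𝕜 (holG (Yf W B) (Yb W B) (loopC δ L μ y b))
      = mk 0 ((loopC B L μ y b).sum) ((loopC W L μ y b).sum)
          ((2 : 𝕜)⁻¹ • ((loopC (bw W B) L μ y b).sum + cross (loopC (pairForm W B) L μ y b))) := by
    intro b hbx
    have hl := lettersIn_loopC δ L μ y hbx
    obtain ⟨h0, h1, h1'⟩ := holY_c W B hl
    have hx := hol_cross W B hl
    rw [loopC_map, mapForm_letterHom] at h1 h1'
    simp only [loopC_map, mapForm_letterHom, mapForm_letterHom₂] at hx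
    rw [logT_of_c00 _ h0, h1, h1', half_of_two h2 hx]
  have hb0 : ∀ b ∈ box d L, logT 𝕜 (holG (Yf 0 B) (Yb 0 B) (loopC δ L μ y b))
      = mk 0 ((loopC B L μ y b).sum) 0 0 := by
    intro b hbx
    rw [holY_zero B (lettersIn_loopC δ L μ y hbx), loopC_map, mapForm_letterHom, logT_of_c00 _ (by simp)]
    simp
  -- c-path data
  obtain ⟨k0, k1, k1'⟩ := holY_c W B (lettersIn_cSeg δ L μ y)
  have kx := hol_cross W B (lettersIn_cSeg δ L μ y)
  rw [segUp_map, mapForm_letterHom] at k1 k1'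
  simp only [segUp_map, mapForm_letterHom, mapForm_letterHom₂] at kx
  have kc : holG (Yf W B) (Yb W B) (segUp δ ((L : ℤ) • y) μ L)
      = mk 1 ((segUp B ((L : ℤ) • y) μ L).sum) ((segUp W ((L : ℤ) • y) μ L).sum)
          ((2 : 𝕜)⁻¹ • (((segUp (bw W B) ((L : ℤ) • y) μ L).sum
              + cross (segUp (pairForm W B) ((L : ℤ) • y) μ L))
            + ((segUp B ((L : ℤ) • y) μ L).sum * (segUp W ((L : ℤ) • y) μ L).sum
              + (segUp W ((L : ℤ) • y) μ L).sum * (segUp B ((L : ℤ) • y) μ L).sum))) := by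
    rw [← mk_eq (holG (Yf W B) (Yb W B) (segUp δ ((L : ℤ) • y) μ L)), k0, k1, k1', eq_half h2 kx]
  have kc0 : holG (Yf 0 B) (Yb 0 B) (segUp δ ((L : ℤ) • y) μ L) = mk 1 ((segUp B ((L : ℤ) • y) μ L).sum) 0 0 := by
    rw [holY_zero B (lettersIn_cSeg δ L μ y), segUp_map, mapForm_letterHom]
  -- assemble (42) on both shadows
  rw [PhiG, PhiG, Finset.sum_congr rfl hb, Finset.sum_congr rfl hb0, kc, kc0, sum_mk_zero, sum_mk_zero, smul_mk,
    smul_mk, expT_of_c00 _ (by simp), expT_of_c00 _ (by simp)]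
  simp only [c10_mk, c01_mk, c11_mk, Finset.sum_const_zero, smul_zero, mul_zero, zero_mul, add_zero,
    smul_zero]
  -- the zero shadow: Φ₀ = (1 + σ a₁)(1 + σ c_B), invert
  rw [show ∀ a c : 𝔸, mk (1 : 𝔸) a 0 0 * mk 1 c 0 0 = mk 1 (a + c) 0 0 from
    fun a c => ext4 (by simp) (by simp [add_comm]) (by simp) (by simp), invT_mk_one]
  -- the product Z and its logarithm
  rw [logT_of_c00 _ (by simp)]
  simp only [c11_mk, c10_mk, c01_mk, c00_mk, c11_mul, c10_mul, c01_mul, c00_mul, c00_mk]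
  simp only [mul_one, one_mul, mul_zero, add_zero, zero_add, mul_neg]
  -- contour bookkeeping and node 7a's definitions
  rw [← Finset.smul_sum, Finset.sum_add_distrib, eq_sub_of_add_eq (sum_box_sum_loopC_add W L μ y),
    eq_sub_of_add_eq (sum_box_sum_loopC_add B L μ y), eq_sub_of_add_eq (sum_box_sum_loopC_add (bw W B) L μ y)]
  simp only [vhU, hessU, AveragingHessianKernels.comm, ← Nat.cast_smul_eq_nsmul 𝕜, ← Int.cast_smul_eq_zsmul 𝕜,
    Nat.cast_pow, Int.cast_pow, Int.cast_natCast, pow_mul']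
  -- the letter functionals are now opaque atoms of a `𝕜`-module identity
  generalize (∑ b ∈ box d L, cross (loopC (pairForm W B) L μ y b)) = Xb
  generalize cross (segUp (pairForm W B) ((L : ℤ) • y) μ L) = Xc
  generalize linAvg (bw W B) L μ y = Lbw
  generalize (segUp (bw W B) ((L : ℤ) • y) μ L).sum = cbw
  generalize linAvg B L μ y = lB
  generalize linAvg W L μ y = lW
  generalize (segUp B ((L : ℤ) • y) μ L).sum = cB
  generalize (segUp W ((L : ℤ) • y) μ L).sum = cW
  generalize ((L : 𝕜) ^ d) = ℓ at hℓ ⊢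
  simp only [smul_sub, smul_add, smul_neg, neg_add, mul_add, add_mul, mul_sub, sub_mul, mul_neg, neg_mul,
    smul_mul_assoc, mul_smul_comm, smul_smul]
  match_scalars <;> (field_simp; try ring)

/-- [folklore] ORDER-`1` IDENTIFICATION, `B`-slot: the `τ₁`-component of the averaged jet of `W` is node 7a's
second-variation kernel functional `(2L^{2d})⁻¹ • vhU W B` (so `T₁(W;B) = ½ L^{-2d} vhU`, nodes 7a/7b). -/
theorem c10_Qjet (W B B' : Form1 d 𝔸) {L : ℕ} (hL : (L : 𝕜) ≠ 0) (h2 : (2 : 𝕜) ≠ 0) (μ : Fin d)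
    (y : Fin d → ℤ) :
    c10 (Qjet 𝕜 (upF W) B B' L μ y) = ((2 : 𝕜) * (L : 𝕜) ^ (2 * d))⁻¹ • vhU W B L μ y := by
  have hG : ∀ κ x, piB (𝕜 := 𝕜) (Gf (upF W) B B' κ x) = Yf W B κ x :=
    fun κ x => ext4 (by simp [Yf]) (by simp [Yf]) (by simp [Yf]) (by simp [Yf])
  have hGb : ∀ κ x, piB (𝕜 := 𝕜) (Gb (upF W) B B' κ x) = Yb W B κ x :=
    fun κ x => ext4 (by simp [Yb]) (by simp [Yb]) (by simp [Yb]) (by simp [Yb])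
  have hG0 : ∀ κ x, piB (𝕜 := 𝕜) (Gf 0 B B' κ x) = Yf 0 B κ x :=
    fun κ x => ext4 (by simp [Yf]) (by simp [Yf]) (by simp [Yf]) (by simp [Yf])
  have hGb0 : ∀ κ x, piB (𝕜 := 𝕜) (Gb 0 B B' κ x) = Yb 0 B κ x :=
    fun κ x => ext4 (by simp [Yb]) (by simp [Yb]) (by simp [Yb]) (by simp [Yb])
  unfold Qjet PhiR
  have key := congrArg c11 (map_logT (R := Rho 𝔸) (R' := Tau 𝔸) (piB (𝕜 := 𝕜))
    (PhiG 𝕜 (Gf (upF W) B B') (Gb (upF W) B B') L μ y * invT (PhiG 𝕜 (Gf 0 B B') (Gb 0 B B') L μ y)))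
  simp only [map_mul, map_invT, map_PhiG, hG, hGb, hG0, hGb0] at key
  rw [piB_apply, c11_mk] at key
  refine key.trans ?_
  exact c11_logT_PhiY W B hL h2 μ y

/-- [folklore] ORDER-`1` IDENTIFICATION, `B′`-slot: the `τ₂`-component of the averaged jet of `W` is
`(2L^{2d})⁻¹ • vhU W B′`. -/
theorem c01_Qjet (W B B' : Form1 d 𝔸) {L : ℕ} (hL : (L : 𝕜) ≠ 0) (h2 : (2 : 𝕜) ≠ 0) (μ : Fin d)
    (y : Fin d → ℤ) :
    c01 (Qjet 𝕜 (upF W) B B' L μ y) = ((2 : 𝕜) * (L : 𝕜) ^ (2 * d))⁻¹ • vhU W B' L μ y := by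
  have hG : ∀ κ x, piB' (𝕜 := 𝕜) (Gf (upF W) B B' κ x) = Yf W B' κ x :=
    fun κ x => ext4 (by simp [Yf]) (by simp [Yf]) (by simp [Yf]) (by simp [Yf])
  have hGb : ∀ κ x, piB' (𝕜 := 𝕜) (Gb (upF W) B B' κ x) = Yb W B' κ x :=
    fun κ x => ext4 (by simp [Yb]) (by simp [Yb]) (by simp [Yb]) (by simp [Yb])
  have hG0 : ∀ κ x, piB' (𝕜 := 𝕜) (Gf 0 B B' κ x) = Yf 0 B' κ x :=
    fun κ x => ext4 (by simp [Yf]) (by simp [Yf]) (by simp [Yf]) (by simp [Yf])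
  have hGb0 : ∀ κ x, piB' (𝕜 := 𝕜) (Gb 0 B B' κ x) = Yb 0 B' κ x :=
    fun κ x => ext4 (by simp [Yb]) (by simp [Yb]) (by simp [Yb]) (by simp [Yb])
  unfold Qjet PhiR
  have key := congrArg c11 (map_logT (R := Rho 𝔸) (R' := Tau 𝔸) (piB' (𝕜 := 𝕜))
    (PhiG 𝕜 (Gf (upF W) B B') (Gb (upF W) B B') L μ y * invT (PhiG 𝕜 (Gf 0 B B') (Gb 0 B B') L μ y)))
  simp only [map_mul, map_invT, map_PhiG, hG, hGb, hG0, hGb0] at key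
  rw [piB'_apply, c11_mk] at key
  refine key.trans ?_
  exact c11_logT_PhiY W B' hL h2 μ y



/-- [folklore] THE WARD IDENTITY IN IDENTIFIED FORM (the typed form certified by the programme's engines, cf. the
header): for `λ ∈ 𝔫_ev`,
`T₂ᵒ(∇λ; B, B′) = −(2L^{2d})⁻¹ • (vhU([B,λ₊]; B′) + vhU([B′,λ₊]; B)) − L^{-d} • linAvg [B,[B′,λ₊]]`. -/
theorem ward_vhU (lam : (Fin d → ℤ) → 𝔸) (B B' : Form1 d 𝔸) {L : ℕ} (hL : (L : 𝕜) ≠ 0) (h2 : (2 : 𝕜) ≠ 0)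
    (μ : Fin d) (y : Fin d → ℤ) (h0 : lam ((L : ℤ) • y) = 0) (h1 : lam ((L : ℤ) • y + (L : ℤ) • unitVec μ) = 0) :
    c11 (Qjet 𝕜 (upF (grad lam)) B B' L μ y)
      = -((((2 : 𝕜) * (L : 𝕜) ^ (2 * d))⁻¹ • vhU (gmode1 B lam) B' L μ y
          + ((2 : 𝕜) * (L : 𝕜) ^ (2 * d))⁻¹ • vhU (gmode1 B' lam) B L μ y)
          + ((L : 𝕜) ^ d)⁻¹ • linAvg (gmode2o B B' lam) L μ y) := by
  have h := ward (𝕜 := 𝕜) lam B B' L μ y h0 h1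
  rw [c01_Qjet _ _ _ hL h2, c10_Qjet _ _ _ hL h2, c00_Qjet _ _ _ hL] at h
  rw [← sub_eq_zero, ← h]
  abel

/-- [folklore] `ward_vhU` in node 11's `𝔫_ev` convention (`∀ y, λ(L•y) = 0`). -/
theorem ward_vhU_of_base {L : ℕ} (lam : (Fin d → ℤ) → 𝔸) (hlam : ∀ y : Fin d → ℤ, lam ((L : ℤ) • y) = 0)
    (B B' : Form1 d 𝔸) (hL : (L : 𝕜) ≠ 0) (h2 : (2 : 𝕜) ≠ 0) (μ : Fin d) (y : Fin d → ℤ) :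
    c11 (Qjet 𝕜 (upF (grad lam)) B B' L μ y)
      = -((((2 : 𝕜) * (L : 𝕜) ^ (2 * d))⁻¹ • vhU (gmode1 B lam) B' L μ y
          + ((2 : 𝕜) * (L : 𝕜) ^ (2 * d))⁻¹ • vhU (gmode1 B' lam) B L μ y)
          + ((L : 𝕜) ^ d)⁻¹ • linAvg (gmode2o B B' lam) L μ y) :=
  ward_vhU lam B B' hL h2 μ y (hlam y) (by rw [← smul_add]; exact hlam _)

end Chart

end

end Literature.MathematicalPhysics.QuantumFieldTheory.Balaban1983to89.Beta.AveragingThirdJet
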